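import Literature.Barriers.Parity.SiegelZeroDichotomyPairHLEq58
import Literature.Barriers.Parity.SiegelZeroDichotomyPairHLEq57Euler
import Literature.NumberTheory.Sieve.LandreauInequality
import Mathlib.Analysis.PSeries
import HarnessLib

/-!
# Tao–Teräväinen 2022, (5.7) at `k = 2`, `ℓ = 0` — proved

Topic `Literature/Barriers/Parity`. This file DISCHARGES the named fact
`Literature.Barriers.Parity.TaoTeravainen2021_eq57_pair` of `SiegelZeroDichotomyPairHLStepTwo.lean`
("`𝔼_{n ≤ x} E(n+h₁) ∏_{j=2}^k (Λν + E + F + G)(n+h_j) ≈ 0`", Tao–Teräväinen arXiv:2109.06291, §5, proof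
of Proposition 5.2, (5.7)) by the printed argument ("Now we turn to (5.7)"):

1. "Observe using (3.10) that `(Λν+E+F+G)(n+h_j) ≪ (∑_{d_j ≤ D: d_j∣n+h_j} τ(d_j)^{O(1)}) ν(n+h_j) log x`
   and so we can bound the left-hand side of (5.7) by
   `≪ (log^k x)(∑_{R₀ < p* ≤ √(2x)} a_{p*} + ∑_{R₀ < p₀ ≤ √(2x)} a_{p₀²})` where
   `a_d := ∑_{d₁,…,d_k ≤ D} τ(d₁⋯d_k)^{O(1)} 𝔼_{n ≤ x} 1_{d∣n+h₁} ∏ 1_{d_j∣n+h_j} ν(n+h_j)`" —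
   `sum_errE_mul_le` (Landreau's inequality `card_divisors_le_sum_of_le` for `τ`, the counts of `E`
   bounded by `2 log(2x)/log R₀`, `F ≤ W_P ν log x`, `Λν, G ≤ log(2x) ν`; `[d∣m][d₁∣m] = [[d,d₁]∣m]`).
2. "Applying Lemma 3.4 … Using Euler products (2.11) … `a_d ≪ τ(d)^{O(1)} log_R^{O(1)} x/(d log^k R) + D^{k+1}R^{2k}/x`"
   — `aCorr_le` (the weighted Lemma 3.4 over an index set, `sieveCorrelation_weighted_le'`, with the
   hypothesis `tau_gain_lcm_sum_le` from `…Eq57Euler.lean`).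
3. "Inserting this into (5.11) and using Corollary 3.6, (2.8), (2.9), we obtain the claim" — the
   η-bookkeeping: `∑ 1/p* ≤ K e^{-√(log η)/2}` (`TaoTeravainen2021_cor36_i_holds`), `∑_{p₀>R₀} 1/p₀² ≤ 2/R₀`,
   all losses being powers of `log_R x = log^{1/10} η` and `log x/log R₀ = √(log η)`; the error
   `≪ √x · R⁴ D^{5/2} log² x` by the divisor bound; Siegel's bound (1.4) for `h_j ≤ x` and `log η ≪ log x`.
   (The source's remark that `d = p₀² > √(2x)` needs separate treatment is unnecessary here: the
   tree's Lemma 3.4 has no restriction on the size of the moduli.)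
[cite: TaoTeravainen2021, §5, proof of Proposition 5.2, (5.7); Lemma 3.1 (ii), (3.10); Lemma 3.4; (2.11), (3.3); Corollary 3.6; (2.3)–(2.6); (1.4)]
-/

noncomputable section

open Finset
open scoped ArithmeticFunction.vonMangoldt ArithmeticFunction.Moebius

namespace Literature.Barriers.Parity

namespace TaoTeravainen

variable {q : ℕ} (χ : DirichletCharacter ℂ q)

/-! ### The hypothesis of Lemma 3.4 for the moduli `([d, d₁], d₂)` -/

/-- **The hypothesis of Lemma 3.4 for the family of (5.7)**: for `T = [1, ⌊D⌋]` (`⌊D⌋ ≥ 2`), `R ≥ 3`,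
`σ ≥ 1`, a prime `p₀` and `j ≥ 0`,
`∑_{d₁,d₂ ∈ T} τ(d₁)^P τ(d₂)^P gainWeight(R; ([p₀^j,d₁], d₂); σ)
  ≤ (1944/p₀^j) · 2^j (1+c_P/2)² max(1, log⌊D⌋/log R)^{N'} e^{25N'} 2^{40N'} · σ^{40N'}`
("`a_d ≪ τ(d)^{O(1)} log_R^{O(1)} x/(d log^k R) + …`": the factor `1/d`, `d = p₀^j`, and only powers
of `log_R D`). [cite: TaoTeravainen2021, §5 (proof of (5.7))] -/
theorem tau_gain_lcm_sum_le {R : ℝ} (hR : 3 ≤ R) {Dr : ℝ} (hM' : 2 ≤ ⌊Dr⌋₊) (P : ℕ) {p₀ : ℕ}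
    (hp : p₀.Prime) (j : ℕ) {σ : ℝ} (hσ : 1 ≤ σ) :
    ∑ dd ∈ fRange Dr ×ˢ fRange Dr,
        ((dd.1.divisors.card : ℕ) : ℝ) ^ P * ((dd.2.divisors.card : ℕ) : ℝ) ^ P *
          gainWeight R ![Nat.lcm (p₀ ^ j) dd.1, dd.2] σ ≤
      1944 / (p₀ : ℝ) ^ j * (2 ^ j * (1 + cA P / 2) ^ 2 *
        ((max 1 (Real.log (⌊Dr⌋₊ : ℕ) / Real.log R)) ^ expN' P * Real.exp (25 * expN' P) *
          2 ^ (40 * expN' P))) * σ ^ (40 * expN' P) := by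
  classical
  set M' := ⌊Dr⌋₊ with hM'def
  set S := Nat.primesBelow (M' + 1) with hSdef
  set Q := primePowerProd S M' with hQdef
  have hS : ∀ p ∈ S, p.Prime := fun p hp' => (Nat.mem_primesBelow.mp hp').2
  have hR1 : 1 < R := by linarith
  have hσ0 : 0 ≤ σ := by linarith
  have hp0 : (0 : ℝ) < (p₀ : ℝ) ^ j := by have := hp.pos; positivity
  -- prime factors of `d ≤ M'` lie in `S`
  have hTS : ∀ d ∈ fRange Dr, d ≠ 0 ∧ d.primeFactors ⊆ S ∧ d ≤ M' := by
    intro d hd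
    have h1 : 1 ≤ d := (Finset.mem_Icc.mp hd).1
    have h2 : d ≤ M' := (Finset.mem_Icc.mp hd).2
    refine ⟨by omega, fun p hp' => ?_, h2⟩
    have hpd := Nat.le_of_mem_primeFactors hp'
    exact Nat.mem_primesBelow.mpr ⟨by omega, Nat.prime_of_mem_primeFactors hp'⟩
  -- termwise
  have hterm : ∀ dd ∈ fRange Dr ×ˢ fRange Dr,
      ((dd.1.divisors.card : ℕ) : ℝ) ^ P * ((dd.2.divisors.card : ℕ) : ℝ) ^ P *
          gainWeight R ![Nat.lcm (p₀ ^ j) dd.1, dd.2] σ ≤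
        1944 / (p₀ : ℝ) ^ j * (twist p₀ j dd.1 * pairW S R σ P dd.1 dd.2) := by
    intro dd hdd
    rw [Finset.mem_product] at hdd
    obtain ⟨h10, h1S, -⟩ := hTS dd.1 hdd.1
    obtain ⟨h20, h2S, -⟩ := hTS dd.2 hdd.2
    have hlcm := gainWeight_lcm_le hR1 hσ hp j h10 h20
    have hpw := tau_pow_mul_gainWeight_le (S := S) hR1 hσ P h10 h20 h1S h2S
    have hτ0 : 0 ≤ ((dd.1.divisors.card : ℕ) : ℝ) ^ P * ((dd.2.divisors.card : ℕ) : ℝ) ^ P := by positivity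
    calc ((dd.1.divisors.card : ℕ) : ℝ) ^ P * ((dd.2.divisors.card : ℕ) : ℝ) ^ P *
          gainWeight R ![Nat.lcm (p₀ ^ j) dd.1, dd.2] σ
        ≤ ((dd.1.divisors.card : ℕ) : ℝ) ^ P * ((dd.2.divisors.card : ℕ) : ℝ) ^ P *
          (1944 * ((p₀ : ℝ) ^ min j (dd.1.factorization p₀) / (p₀ : ℝ) ^ j) * gainWeight R ![dd.1, dd.2] σ) :=
          mul_le_mul_of_nonneg_left hlcm hτ0
      _ = 1944 / (p₀ : ℝ) ^ j * (twist p₀ j dd.1 *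
          (((dd.1.divisors.card : ℕ) : ℝ) ^ P * ((dd.2.divisors.card : ℕ) : ℝ) ^ P * gainWeight R ![dd.1, dd.2] σ)) := by
          unfold twist; ring
      _ ≤ 1944 / (p₀ : ℝ) ^ j * (twist p₀ j dd.1 * pairW S R σ P dd.1 dd.2) :=
          mul_le_mul_of_nonneg_left (mul_le_mul_of_nonneg_left hpw (twist_nonneg _ _ _)) (by positivity)
  -- extend to all pairs of divisors of `Q`
  have hsub : fRange Dr ×ˢ fRange Dr ⊆ Q.divisors ×ˢ Q.divisors := by
    intro dd hdd
    rw [Finset.mem_product] at hdd ⊢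
    have hQ0 : Q ≠ 0 := primePowerProd_ne_zero hS M'
    obtain ⟨h10, h1S, h1K⟩ := hTS dd.1 hdd.1
    obtain ⟨h20, h2S, h2K⟩ := hTS dd.2 hdd.2
    exact ⟨Nat.mem_divisors.mpr ⟨dvd_primePowerProd_of_subset hS h10 h1S h1K, hQ0⟩,
      Nat.mem_divisors.mpr ⟨dvd_primePowerProd_of_subset hS h20 h2S h2K, hQ0⟩⟩
  have hnn : ∀ dd ∈ Q.divisors ×ˢ Q.divisors, 0 ≤ twist p₀ j dd.1 * pairW S R σ P dd.1 dd.2 :=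
    fun dd _ => mul_nonneg (twist_nonneg _ _ _) (pairW_nonneg hS hR1 hσ0 P _ _)
  have hE := sum_twist_pairW_le hM' hR hσ P hp j M'
  rw [← Finset.sum_product'] at hE
  have hσpow : (1 + σ) ^ (40 * expN' P) ≤ 2 ^ (40 * expN' P) * σ ^ (40 * expN' P) := by
    rw [← mul_pow]; exact pow_le_pow_left₀ (by linarith) (by linarith) _
  calc ∑ dd ∈ fRange Dr ×ˢ fRange Dr,
        ((dd.1.divisors.card : ℕ) : ℝ) ^ P * ((dd.2.divisors.card : ℕ) : ℝ) ^ P *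
          gainWeight R ![Nat.lcm (p₀ ^ j) dd.1, dd.2] σ
      ≤ ∑ dd ∈ fRange Dr ×ˢ fRange Dr, 1944 / (p₀ : ℝ) ^ j * (twist p₀ j dd.1 * pairW S R σ P dd.1 dd.2) :=
        Finset.sum_le_sum hterm
    _ = 1944 / (p₀ : ℝ) ^ j * ∑ dd ∈ fRange Dr ×ˢ fRange Dr, twist p₀ j dd.1 * pairW S R σ P dd.1 dd.2 := by
        rw [Finset.mul_sum]
    _ ≤ 1944 / (p₀ : ℝ) ^ j * ∑ dd ∈ Q.divisors ×ˢ Q.divisors, twist p₀ j dd.1 * pairW S R σ P dd.1 dd.2 :=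
        mul_le_mul_of_nonneg_left (Finset.sum_le_sum_of_subset_of_nonneg hsub fun dd hdd _ => hnn dd hdd)
          (by positivity)
    _ ≤ 1944 / (p₀ : ℝ) ^ j * (2 ^ j * (1 + cA P / 2) ^ 2 * ((1 + σ) ^ (40 * expN' P) *
        (max 1 (Real.log M' / Real.log R)) ^ expN' P * Real.exp (25 * expN' P))) :=
        mul_le_mul_of_nonneg_left hE (by positivity)
    _ ≤ 1944 / (p₀ : ℝ) ^ j * (2 ^ j * (1 + cA P / 2) ^ 2 * ((2 ^ (40 * expN' P) * σ ^ (40 * expN' P)) *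
        (max 1 (Real.log M' / Real.log R)) ^ expN' P * Real.exp (25 * expN' P))) := by
        have h0 : 0 ≤ (max 1 (Real.log M' / Real.log R)) ^ expN' P * Real.exp (25 * expN' P) := by
          have : 0 ≤ max 1 (Real.log M' / Real.log R) := le_trans zero_le_one (le_max_left _ _)
          positivity
        have hc := cA_pos P
        have h1 : (1 + σ) ^ (40 * expN' P) * ((max 1 (Real.log M' / Real.log R)) ^ expN' P * Real.exp (25 * expN' P)) ≤
            (2 ^ (40 * expN' P) * σ ^ (40 * expN' P)) * ((max 1 (Real.log M' / Real.log R)) ^ expN' P * Real.exp (25 * expN' P)) :=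
          mul_le_mul_of_nonneg_right hσpow h0
        have h2 : 0 ≤ 1944 / (p₀ : ℝ) ^ j * (2 ^ j * (1 + cA P / 2) ^ 2) := by positivity
        have := mul_le_mul_of_nonneg_left h1 h2
        calc _ = 1944 / (p₀ : ℝ) ^ j * (2 ^ j * (1 + cA P / 2) ^ 2) * ((1 + σ) ^ (40 * expN' P) *
              ((max 1 (Real.log M' / Real.log R)) ^ expN' P * Real.exp (25 * expN' P))) := by ring
          _ ≤ 1944 / (p₀ : ℝ) ^ j * (2 ^ j * (1 + cA P / 2) ^ 2) * ((2 ^ (40 * expN' P) * σ ^ (40 * expN' P)) *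
              ((max 1 (Real.log M' / Real.log R)) ^ expN' P * Real.exp (25 * expN' P))) := this
          _ = _ := by ring
    _ = _ := by ring

/-! ### The divisor weights `W_P(m) = ∑_{d ≤ D, d ∣ m} τ(d)^P` -/

/-- `W_P(m) = ∑_{d ∈ T} τ(d)^P 1_{d ∣ m}`. [cite: TaoTeravainen2021, §5 (proof of (5.7): "`∑_{d_j ≤ D: d_j∣n+h_j} τ(d_j)^{O(1)}`")] -/
def tauW (Dr : ℝ) (P m : ℕ) : ℝ :=
  ∑ d ∈ fRange Dr, ((d.divisors.card : ℕ) : ℝ) ^ P * (if d ∣ m then 1 else 0)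

/-- `W_P ≥ 1` (`D ≥ 1`, the term `d = 1`). [folklore] -/
theorem one_le_tauW {Dr : ℝ} (hDr : 1 ≤ Dr) (P m : ℕ) : 1 ≤ tauW Dr P m := by
  unfold tauW
  have h1 : 1 ∈ fRange Dr := Finset.mem_Icc.mpr ⟨le_rfl, Nat.le_floor (by exact_mod_cast hDr)⟩
  rw [← Finset.add_sum_erase _ _ h1]
  simp only [Nat.divisors_one, Finset.card_singleton, Nat.cast_one, one_pow, one_dvd, if_true, mul_one]
  have : 0 ≤ ∑ d ∈ (fRange Dr).erase 1, ((d.divisors.card : ℕ) : ℝ) ^ P * (if d ∣ m then (1 : ℝ) else 0) :=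
    Finset.sum_nonneg fun d _ => by split_ifs <;> positivity
  linarith

/-- `W_P ≥ 0`. [folklore] -/
theorem tauW_nonneg (Dr : ℝ) (P m : ℕ) : 0 ≤ tauW Dr P m := by
  unfold tauW
  exact Finset.sum_nonneg fun d _ => by split_ifs <;> positivity

/-- Landreau's sum is dominated by `W_P`: `∑_{d ∣ m, d ≤ y} τ(d)^M ≤ W_P(m)` for `y ≤ D`, `M ≤ P`.
[cite: TaoTeravainen2021, Lemma 3.1 (ii), (3.10)] -/
theorem landreauSum_le_tauW {y Dr : ℝ} (hy : y ≤ Dr) {M P : ℕ} (hMP : M ≤ P) (m : ℕ) :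
    ∑ d ∈ m.divisors, (if (d : ℝ) ≤ y then ((d.divisors.card : ℕ) : ℝ) ^ M else 0) ≤ tauW Dr P m := by
  classical
  unfold tauW
  rw [← Finset.sum_filter]
  have hrhs : ∑ d ∈ fRange Dr, ((d.divisors.card : ℕ) : ℝ) ^ P * (if d ∣ m then (1 : ℝ) else 0) =
      ∑ d ∈ (fRange Dr).filter (fun d => d ∣ m), ((d.divisors.card : ℕ) : ℝ) ^ P := by
    rw [Finset.sum_filter]
    exact Finset.sum_congr rfl fun d _ => by split_ifs <;> simp
  rw [hrhs]
  have hsub : m.divisors.filter (fun d : ℕ => (d : ℝ) ≤ y) ⊆ (fRange Dr).filter (fun d => d ∣ m) := by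
    intro d hd
    rw [Finset.mem_filter] at hd ⊢
    have hd1 : 1 ≤ d := Nat.succ_le_of_lt (Nat.pos_of_mem_divisors hd.1)
    exact ⟨Finset.mem_Icc.mpr ⟨hd1, Nat.le_floor (hd.2.trans hy)⟩, Nat.dvd_of_mem_divisors hd.1⟩
  refine (Finset.sum_le_sum_of_subset_of_nonneg hsub fun d _ _ => by positivity).trans ?_
  refine Finset.sum_le_sum fun d hd => ?_
  have hd1 : 1 ≤ d := (Finset.mem_Icc.mp (Finset.mem_filter.mp hd).1).1
  have hτ1 : (1 : ℝ) ≤ ((d.divisors.card : ℕ) : ℝ) := by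
    have : 1 ≤ d.divisors.card := Finset.card_pos.mpr ⟨1, Nat.one_mem_divisors.mpr (by omega)⟩
    exact_mod_cast this
  exact pow_le_pow_right₀ hτ1 hMP

/-- `errFSum ≤ W_P` for `A ≤ P`. [cite: TaoTeravainen2021, Lemma 5.1 (5.5)] -/
theorem errFSum_le_tauW (R₀ : ℝ) {Dr : ℝ} {A P : ℕ} (hAP : A ≤ P) {m : ℕ} (hm : m ≠ 0) :
    errFSum R₀ Dr A m ≤ tauW Dr P m := by
  rw [errFSum_eq_sum_fRange A hm]
  unfold tauW
  refine Finset.sum_le_sum fun d hd => ?_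
  have hind : (0 : ℝ) ≤ (if d ∣ m then (1 : ℝ) else 0) := by split_ifs <;> norm_num
  refine mul_le_mul_of_nonneg_right ?_ hind
  have hd1 : 1 ≤ d := (Finset.mem_Icc.mp hd).1
  have hτ1 : (1 : ℝ) ≤ ((d.divisors.card : ℕ) : ℝ) := by
    have : 1 ≤ d.divisors.card := Finset.card_pos.mpr ⟨1, Nat.one_mem_divisors.mpr (by omega)⟩
    exact_mod_cast this
  unfold fWeight
  split_ifs
  · exact pow_le_pow_right₀ hτ1 hAP
  · positivity
  · positivity

/-! ### Counting prime factors above `R₀` -/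

/-- `#{p > R₀ : p ∣ m} ≤ log m / log R₀` for `m ≥ 1`, `R₀ > 1` (the product of these primes divides `m`).
[folklore] -/
theorem card_filter_prime_gt_dvd_le {R₀ : ℝ} (hR₀ : 1 < R₀) {m : ℕ} (hm : m ≠ 0) (s : Finset ℕ) :
    (#(s.filter fun p : ℕ => p.Prime ∧ R₀ < (p : ℝ) ∧ p ∣ m) : ℝ) ≤ Real.log m / Real.log R₀ := by
  set F := s.filter fun p : ℕ => p.Prime ∧ R₀ < (p : ℝ) ∧ p ∣ m with hF
  have hlogR₀ : 0 < Real.log R₀ := Real.log_pos hR₀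
  have hprod : ∏ p ∈ F, p ∣ m :=
    Finset.prod_primes_dvd m (fun p hp => ((Finset.mem_filter.mp hp).2.1).prime)
      fun p hp => (Finset.mem_filter.mp hp).2.2.2
  have hle : (R₀ : ℝ) ^ #F ≤ m := by
    calc (R₀ : ℝ) ^ #F = ∏ _p ∈ F, R₀ := (Finset.prod_const _).symm
      _ ≤ ∏ p ∈ F, (p : ℝ) := Finset.prod_le_prod (fun _ _ => by linarith)
          fun p hp => (Finset.mem_filter.mp hp).2.2.1.le
      _ = ((∏ p ∈ F, p : ℕ) : ℝ) := by push_cast; rfl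
      _ ≤ m := by exact_mod_cast Nat.le_of_dvd (Nat.pos_of_ne_zero hm) hprod
  have hlog := Real.log_le_log (by positivity) hle
  rw [Real.log_pow] at hlog
  rw [le_div_iff₀ hlogR₀]
  exact hlog

/-- **`E(m) ≤ 2 (log m/log R₀) τ(m) ν(m) log x`** (both counts in `E` are at most `#{p > R₀ : p ∣ m}`).
[cite: TaoTeravainen2021, Lemma 5.1 (5.4)] -/
theorem errE_le_log {ψ : ℝ → ℝ} {R R₀ : ℝ} (hR₀ : 1 < R₀) {x m : ℕ} (hm : m ≠ 0) (hx : 1 ≤ x) :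
    errE χ ψ R R₀ x m ≤ 2 * (Real.log m / Real.log R₀) * (m.divisors.card : ℝ) * selbergSieve ψ R m *
      Real.log x := by
  unfold errE
  have hν := selbergSieve_nonneg ψ R m
  have hlogx : 0 ≤ Real.log x := Real.log_nonneg (by exact_mod_cast hx)
  have hcount := card_filter_prime_gt_dvd_le hR₀ hm (Finset.range (m + 1))
  have h1 : (#((Finset.range (m + 1)).filter fun p : ℕ =>
      p.Prime ∧ realChar χ p ≠ -1 ∧ R₀ < (p : ℝ) ∧ (p : ℝ) ≤ Real.sqrt (2 * x) ∧ p ∣ m) : ℝ) ≤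
        Real.log m / Real.log R₀ := by
    refine le_trans ?_ hcount
    exact_mod_cast Finset.card_le_card (fun p hp => by
      rw [Finset.mem_filter] at hp ⊢
      exact ⟨hp.1, hp.2.1, hp.2.2.2.1, hp.2.2.2.2.2⟩)
  have h2 : (#((Finset.range (m + 1)).filter fun p : ℕ =>
      p.Prime ∧ R₀ < (p : ℝ) ∧ (p : ℝ) ≤ Real.sqrt (2 * x) ∧ p ^ 2 ∣ m) : ℝ) ≤ Real.log m / Real.log R₀ := by
    refine le_trans ?_ hcount
    exact_mod_cast Finset.card_le_card (fun p hp => by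
      rw [Finset.mem_filter] at hp ⊢
      exact ⟨hp.1, hp.2.1, hp.2.2.1, (dvd_pow_self p two_ne_zero).trans hp.2.2.2.2⟩)
  have hτ : 0 ≤ (m.divisors.card : ℝ) := Nat.cast_nonneg _
  have hsum : ((#((Finset.range (m + 1)).filter fun p : ℕ =>
        p.Prime ∧ realChar χ p ≠ -1 ∧ R₀ < (p : ℝ) ∧ (p : ℝ) ≤ Real.sqrt (2 * x) ∧ p ∣ m) : ℝ) +
      #((Finset.range (m + 1)).filter fun p : ℕ =>
        p.Prime ∧ R₀ < (p : ℝ) ∧ (p : ℝ) ≤ Real.sqrt (2 * x) ∧ p ^ 2 ∣ m)) ≤ 2 * (Real.log m / Real.log R₀) := by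
    linarith
  have := mul_le_mul_of_nonneg_right (mul_le_mul_of_nonneg_right (mul_le_mul_of_nonneg_right hsum hτ) hν) hlogx
  linarith


/-! ### The pointwise reduction of (5.7) -/

/-- The exceptional primes `p*` with `R₀ < p* ≤ √(2x)` (as a fixed index set). [cite: TaoTeravainen2021, Lemma 5.1 (5.4)] -/
def excRange (R₀ : ℝ) (x : ℕ) : Finset ℕ :=
  (Finset.range (2 * x + 1)).filter fun p : ℕ =>
    p.Prime ∧ realChar χ p ≠ -1 ∧ R₀ < (p : ℝ) ∧ (p : ℝ) ≤ Real.sqrt (2 * x)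

/-- The primes `p₀` with `R₀ < p₀ ≤ √(2x)` (as a fixed index set). [cite: TaoTeravainen2021, Lemma 5.1 (5.4)] -/
def sqRange (R₀ : ℝ) (x : ℕ) : Finset ℕ :=
  (Finset.range (2 * x + 1)).filter fun p : ℕ => p.Prime ∧ R₀ < (p : ℝ) ∧ (p : ℝ) ≤ Real.sqrt (2 * x)

/-- The weighted correlation sum `a_e = ∑_{d₁,d₂ ∈ T} τ(d₁)^P τ(d₂)^P S(([e,d₁], d₂))` of the proof of (5.7).
[cite: TaoTeravainen2021, §5 (proof of (5.7), the quantity `a_d`)] -/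
def aCorr (ψ : ℝ → ℝ) (R Dr : ℝ) (P h₁ h₂ x e : ℕ) : ℝ :=
  ∑ d₁ ∈ fRange Dr, ∑ d₂ ∈ fRange Dr, ((d₁.divisors.card : ℕ) : ℝ) ^ P * ((d₂.divisors.card : ℕ) : ℝ) ^ P *
    sieveCorrelation ψ R h₁ h₂ ![Nat.lcm e d₁, d₂] x

/-- `a_e ≥ 0`. [folklore] -/
theorem aCorr_nonneg (ψ : ℝ → ℝ) (R Dr : ℝ) (P h₁ h₂ x e : ℕ) : 0 ≤ aCorr ψ R Dr P h₁ h₂ x e := by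
  unfold aCorr sieveCorrelation
  refine Finset.sum_nonneg fun d₁ _ => Finset.sum_nonneg fun d₂ _ => mul_nonneg (by positivity) ?_
  refine Finset.sum_nonneg fun n _ => mul_nonneg ?_ ?_ <;>
    exact mul_nonneg (selbergSieve_nonneg _ _ _) (by split_ifs <;> norm_num)

/-- The counts in `E(m)` over the fixed index sets (`1 ≤ m ≤ 2x`). [folklore] -/
theorem errE_count_eq {R₀ : ℝ} {x m : ℕ} (hm : m ≠ 0) (hmx : m ≤ 2 * x) :
    ((#((Finset.range (m + 1)).filter fun p : ℕ =>
        p.Prime ∧ realChar χ p ≠ -1 ∧ R₀ < (p : ℝ) ∧ (p : ℝ) ≤ Real.sqrt (2 * x) ∧ p ∣ m) : ℝ) +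
      #((Finset.range (m + 1)).filter fun p : ℕ =>
        p.Prime ∧ R₀ < (p : ℝ) ∧ (p : ℝ) ≤ Real.sqrt (2 * x) ∧ p ^ 2 ∣ m)) =
    ∑ p ∈ excRange χ R₀ x, (if p ∣ m then (1 : ℝ) else 0) +
      ∑ p ∈ sqRange R₀ x, (if p ^ 2 ∣ m then (1 : ℝ) else 0) := by
  classical
  rw [Finset.sum_boole, Finset.sum_boole]
  congr 2
  · congr 1
    ext p
    simp only [excRange, Finset.mem_filter, Finset.mem_range]
    constructor
    · rintro ⟨-, hp, hχ, hR, hs, hd⟩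
      have := Nat.le_of_dvd (Nat.pos_of_ne_zero hm) hd
      exact ⟨⟨by omega, hp, hχ, hR, hs⟩, hd⟩
    · rintro ⟨⟨-, hp, hχ, hR, hs⟩, hd⟩
      have := Nat.le_of_dvd (Nat.pos_of_ne_zero hm) hd
      exact ⟨by omega, hp, hχ, hR, hs, hd⟩
  · congr 1
    ext p
    simp only [sqRange, Finset.mem_filter, Finset.mem_range]
    constructor
    · rintro ⟨-, hp, hR, hs, hd⟩
      have := Nat.le_of_dvd (Nat.pos_of_ne_zero hm) ((dvd_pow_self p two_ne_zero).trans hd)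
      exact ⟨⟨by omega, hp, hR, hs⟩, hd⟩
    · rintro ⟨⟨-, hp, hR, hs⟩, hd⟩
      have := Nat.le_of_dvd (Nat.pos_of_ne_zero hm) ((dvd_pow_self p two_ne_zero).trans hd)
      exact ⟨by omega, hp, hR, hs, hd⟩

/-- `∑_n 1_{e ∣ n+h₁} W(n+h₁) W(n+h₂) ν(n+h₁) ν(n+h₂) = a_e` (`[e ∣ m][d₁ ∣ m] = [[e,d₁] ∣ m]`). [folklore] -/
theorem sum_ind_mul_tauW_eq (ψ : ℝ → ℝ) (R Dr : ℝ) (P h₁ h₂ x e : ℕ) :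
    ∑ n ∈ Icc 1 x, (if e ∣ n + h₁ then (1 : ℝ) else 0) * tauW Dr P (n + h₁) * tauW Dr P (n + h₂) *
        selbergSieve ψ R (n + h₁) * selbergSieve ψ R (n + h₂) =
      aCorr ψ R Dr P h₁ h₂ x e := by
  classical
  unfold aCorr tauW sieveCorrelation
  -- expand the products of sums
  have hpt : ∀ n : ℕ, (if e ∣ n + h₁ then (1 : ℝ) else 0) *
      (∑ d ∈ fRange Dr, ((d.divisors.card : ℕ) : ℝ) ^ P * (if d ∣ n + h₁ then 1 else 0)) *
      (∑ d ∈ fRange Dr, ((d.divisors.card : ℕ) : ℝ) ^ P * (if d ∣ n + h₂ then 1 else 0)) *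
      selbergSieve ψ R (n + h₁) * selbergSieve ψ R (n + h₂) =
      ∑ d₁ ∈ fRange Dr, ∑ d₂ ∈ fRange Dr, ((d₁.divisors.card : ℕ) : ℝ) ^ P * ((d₂.divisors.card : ℕ) : ℝ) ^ P *
        ((selbergSieve ψ R (n + h₁) * (if Nat.lcm e d₁ ∣ n + h₁ then 1 else 0)) *
          (selbergSieve ψ R (n + h₂) * (if d₂ ∣ n + h₂ then 1 else 0))) := by
    intro n
    set S₁ := ∑ d ∈ fRange Dr, ((d.divisors.card : ℕ) : ℝ) ^ P * (if d ∣ n + h₁ then (1 : ℝ) else 0) with hS₁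
    set S₂ := ∑ d ∈ fRange Dr, ((d.divisors.card : ℕ) : ℝ) ^ P * (if d ∣ n + h₂ then (1 : ℝ) else 0) with hS₂
    set ind := (if e ∣ n + h₁ then (1 : ℝ) else 0) with hind
    set ν₁ := selbergSieve ψ R (n + h₁) with hν₁
    set ν₂ := selbergSieve ψ R (n + h₂) with hν₂
    rw [show ind * S₁ * S₂ * ν₁ * ν₂ = (ind * ν₁ * ν₂) * (S₁ * S₂) by ring, hS₁, hS₂, Finset.sum_mul_sum,
      Finset.mul_sum]
    refine Finset.sum_congr rfl fun d₁ _ => ?_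
    rw [Finset.mul_sum]
    refine Finset.sum_congr rfl fun d₂ _ => ?_
    have hlcm : (if e ∣ n + h₁ then (1 : ℝ) else 0) * (if d₁ ∣ n + h₁ then (1 : ℝ) else 0) =
        (if Nat.lcm e d₁ ∣ n + h₁ then (1 : ℝ) else 0) := by
      by_cases h : Nat.lcm e d₁ ∣ n + h₁
      · rw [if_pos h, if_pos ((Nat.dvd_lcm_left e d₁).trans h), if_pos ((Nat.dvd_lcm_right e d₁).trans h),
          one_mul]
      · rw [if_neg h]
        by_cases he : e ∣ n + h₁
        · have hd : ¬ d₁ ∣ n + h₁ := fun hd => h (Nat.lcm_dvd he hd)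
          rw [if_neg hd, mul_zero]
        · rw [if_neg he, zero_mul]
    rw [← hlcm, hind, hν₁, hν₂]
    ring
  simp_rw [hpt]
  rw [Finset.sum_comm]
  refine Finset.sum_congr rfl fun d₁ _ => ?_
  rw [Finset.sum_comm]
  refine Finset.sum_congr rfl fun d₂ _ => ?_
  rw [← Finset.mul_sum]
  rfl


/-- **The reduction of (5.7) to the correlation sums `a_d`** ("Observe using (3.10) that
`(Λν + E + F + G)(n+h_j) ≪ (∑_{d_j ≤ D: d_j∣n+h_j} τ(d_j)^{O(1)}) ν(n+h_j) log x` and so we can bound the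
left-hand side of (5.7) by `≪ (log^k x)(∑_{R₀ < p* ≤ √(2x)} a_{p*} + ∑_{R₀ < p₀ ≤ √(2x)} a_{p₀²})`"), at
`k = 2` with explicit factors: `τ ≤ C_L W_P` by Landreau's inequality (`hLand`), the counts in `E(n+h₂)` are
`≤ 2 log(2x)/log R₀`, `F ≤ W_P ν log x`, `Λν, G ≤ log(2x) ν`.
[cite: TaoTeravainen2021, §5 (proof of (5.7), reduction to `a_d`); Lemma 3.1 (ii), (3.10)] -/
theorem sum_errE_mul_le {ψ : ℝ → ℝ} (hψ : IsSmoothCutoff ψ) {R : ℝ} (hR : 1 < R) {x h₁ h₂ : ℕ}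
    (hRx : R ≤ Real.sqrt x) (hh₁ : h₁ ≤ x) (hh₂ : h₂ ≤ x) (hx : 2 ≤ x) {R₀ : ℝ} (hR₀ : 1 < R₀)
    {Dr : ℝ} (hDr : 1 ≤ Dr) {A P : ℕ} (hAP : A ≤ P) {CL y : ℝ} (hCL : 0 < CL) {ML : ℕ} (hML : ML ≤ P)
    (hy : y ≤ Dr)
    (hLand : ∀ n : ℕ, n ≠ 0 → (n : ℝ) ≤ 2 * x → (n.divisors.card : ℝ) ≤
      CL * ∑ d ∈ n.divisors, (if (d : ℝ) ≤ y then ((d.divisors.card : ℕ) : ℝ) ^ ML else 0)) :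
    ∑ n ∈ Icc 1 x, errE χ ψ R R₀ x (n + h₁) *
        (sievedVonMangoldt ψ R (n + h₂) + errE χ ψ R R₀ x (n + h₂) + errF ψ R R₀ Dr A x (n + h₂) +
          errG χ ψ R x (n + h₂)) ≤
      CL * Real.log x * (2 * Real.log (2 * x) + 2 * Real.log (2 * x) * CL * Real.log x / Real.log R₀ +
        Real.log x) *
        (∑ p ∈ excRange χ R₀ x, aCorr ψ R Dr P h₁ h₂ x p + ∑ p ∈ sqRange R₀ x, aCorr ψ R Dr P h₁ h₂ x (p ^ 2)) := by
  classical
  have hx2 : (2 : ℝ) ≤ x := by exact_mod_cast hx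
  have hx1 : (1 : ℝ) ≤ x := by linarith
  have hx0 : (0 : ℝ) < x := by linarith
  set u := Real.log x with hu
  set L₂ := Real.log (2 * x) with hL₂
  have hu0 : 0 ≤ u := Real.log_nonneg hx1
  have huL : u ≤ L₂ := Real.log_le_log hx0 (by linarith)
  have hL₂0 : 0 ≤ L₂ := hu0.trans huL
  have hlogR₀ : 0 < Real.log R₀ := Real.log_pos hR₀
  set Ξ := 2 * L₂ + 2 * L₂ * CL * u / Real.log R₀ + u with hΞ
  have hΞ0 : 0 ≤ Ξ := by positivity
  -- pointwise
  have hpt : ∀ n ∈ Icc 1 x,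
      errE χ ψ R R₀ x (n + h₁) *
          (sievedVonMangoldt ψ R (n + h₂) + errE χ ψ R R₀ x (n + h₂) + errF ψ R R₀ Dr A x (n + h₂) +
            errG χ ψ R x (n + h₂)) ≤
        CL * u * Ξ * ((∑ p ∈ excRange χ R₀ x, (if p ∣ n + h₁ then (1 : ℝ) else 0) +
            ∑ p ∈ sqRange R₀ x, (if p ^ 2 ∣ n + h₁ then (1 : ℝ) else 0)) *
          tauW Dr P (n + h₁) * tauW Dr P (n + h₂) * selbergSieve ψ R (n + h₁) * selbergSieve ψ R (n + h₂)) := by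
    intro n hn
    rw [Finset.mem_Icc] at hn
    obtain ⟨hn1, hnx⟩ := hn
    have hm1 : n + h₁ ≠ 0 := by omega
    have hm2 : n + h₂ ≠ 0 := by omega
    have hm1x : n + h₁ ≤ 2 * x := by omega
    have hm2x : n + h₂ ≤ 2 * x := by omega
    have hm2x' : ((n + h₂ : ℕ) : ℝ) ≤ 2 * x := by exact_mod_cast hm2x
    have hm1x' : ((n + h₁ : ℕ) : ℝ) ≤ 2 * x := by exact_mod_cast hm1x
    set ν₁ := selbergSieve ψ R (n + h₁) with hν₁
    set ν₂ := selbergSieve ψ R (n + h₂) with hν₂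
    have hν₁0 : 0 ≤ ν₁ := selbergSieve_nonneg ψ R _
    have hν₂0 : 0 ≤ ν₂ := selbergSieve_nonneg ψ R _
    set W₁ := tauW Dr P (n + h₁) with hW₁
    set W₂ := tauW Dr P (n + h₂) with hW₂
    have hW₁1 : 1 ≤ W₁ := one_le_tauW hDr P _
    have hW₂1 : 1 ≤ W₂ := one_le_tauW hDr P _
    have hW₁0 : 0 ≤ W₁ := by linarith
    have hW₂0 : 0 ≤ W₂ := by linarith
    -- Landreau
    have hτ₁ : ((n + h₁).divisors.card : ℝ) ≤ CL * W₁ :=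
      (hLand _ hm1 hm1x').trans (mul_le_mul_of_nonneg_left (landreauSum_le_tauW hy hML _) hCL.le)
    have hτ₂ : ((n + h₂).divisors.card : ℝ) ≤ CL * W₂ :=
      (hLand _ hm2 hm2x').trans (mul_le_mul_of_nonneg_left (landreauSum_le_tauW hy hML _) hCL.le)
    -- the second factor
    have hlogm₂ : Real.log ((n + h₂ : ℕ) : ℝ) ≤ L₂ :=
      Real.log_le_log (by exact_mod_cast Nat.pos_of_ne_zero hm2) hm2x'
    have hlogm₂0 : 0 ≤ Real.log ((n + h₂ : ℕ) : ℝ) := Real.log_nonneg (by exact_mod_cast Nat.pos_of_ne_zero hm2)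
    have hΛν : sievedVonMangoldt ψ R (n + h₂) ≤ L₂ * ν₂ * W₂ := by
      unfold sievedVonMangoldt
      calc Λ (n + h₂) * selbergSieve ψ R (n + h₂) ≤ L₂ * ν₂ :=
            mul_le_mul_of_nonneg_right (ArithmeticFunction.vonMangoldt_le_log.trans hlogm₂) hν₂0
        _ = L₂ * ν₂ * 1 := (mul_one _).symm
        _ ≤ L₂ * ν₂ * W₂ := mul_le_mul_of_nonneg_left hW₂1 (by positivity)
    have hE₂ : errE χ ψ R R₀ x (n + h₂) ≤ 2 * (L₂ / Real.log R₀) * (CL * W₂) * ν₂ * u := by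
      refine (errE_le_log χ hR₀ hm2 (by omega : 1 ≤ x)).trans ?_
      have h1 : Real.log ((n + h₂ : ℕ) : ℝ) / Real.log R₀ ≤ L₂ / Real.log R₀ :=
        div_le_div_of_nonneg_right hlogm₂ hlogR₀.le
      have h2 : 0 ≤ Real.log ((n + h₂ : ℕ) : ℝ) / Real.log R₀ := by positivity
      have hτ0 : 0 ≤ ((n + h₂).divisors.card : ℝ) := Nat.cast_nonneg _
      calc 2 * (Real.log ((n + h₂ : ℕ) : ℝ) / Real.log R₀) * ((n + h₂).divisors.card : ℝ) *
            selbergSieve ψ R (n + h₂) * Real.log x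
          ≤ 2 * (L₂ / Real.log R₀) * (CL * W₂) * selbergSieve ψ R (n + h₂) * Real.log x := by
            gcongr
      _ = _ := by rw [hν₂, hu]
    have hF₂ : errF ψ R R₀ Dr A x (n + h₂) ≤ W₂ * ν₂ * u := by
      rw [errF_eq]
      exact mul_le_mul_of_nonneg_right (mul_le_mul_of_nonneg_right (errFSum_le_tauW R₀ hAP hm2) hν₂0) hu0
    have hG₂ : errG χ ψ R x (n + h₂) ≤ L₂ * ν₂ * W₂ := by
      calc errG χ ψ R x (n + h₂) ≤ L₂ * ν₂ := errG_le_log_mul_selbergSieve χ hψ hR hRx (by omega) hm2x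
        _ = L₂ * ν₂ * 1 := (mul_one _).symm
        _ ≤ L₂ * ν₂ * W₂ := mul_le_mul_of_nonneg_left hW₂1 (by positivity)
    have hsecond : sievedVonMangoldt ψ R (n + h₂) + errE χ ψ R R₀ x (n + h₂) + errF ψ R R₀ Dr A x (n + h₂) +
        errG χ ψ R x (n + h₂) ≤ Ξ * W₂ * ν₂ := by
      have : Ξ * W₂ * ν₂ = L₂ * ν₂ * W₂ + 2 * (L₂ / Real.log R₀) * (CL * W₂) * ν₂ * u + W₂ * ν₂ * u +
          L₂ * ν₂ * W₂ := by rw [hΞ]; ring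
      rw [this]
      linarith
    -- the first factor
    have hcnt := errE_count_eq χ (R₀ := R₀) hm1 hm1x
    set cnt := ∑ p ∈ excRange χ R₀ x, (if p ∣ n + h₁ then (1 : ℝ) else 0) +
      ∑ p ∈ sqRange R₀ x, (if p ^ 2 ∣ n + h₁ then (1 : ℝ) else 0) with hcntdef
    have hcnt0 : 0 ≤ cnt := add_nonneg (Finset.sum_nonneg fun p _ => by split_ifs <;> norm_num)
      (Finset.sum_nonneg fun p _ => by split_ifs <;> norm_num)
    have hE₁ : errE χ ψ R R₀ x (n + h₁) ≤ cnt * (CL * W₁) * ν₁ * u := by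
      unfold errE
      rw [hcnt]
      have hτ0 : 0 ≤ ((n + h₁).divisors.card : ℝ) := Nat.cast_nonneg _
      calc cnt * ((n + h₁).divisors.card : ℝ) * selbergSieve ψ R (n + h₁) * Real.log x
          ≤ cnt * (CL * W₁) * selbergSieve ψ R (n + h₁) * Real.log x := by gcongr
        _ = _ := by rw [hν₁, hu]
    have hE₁0 : 0 ≤ errE χ ψ R R₀ x (n + h₁) := errE_nonneg χ ψ R R₀ x _
    have hsecond0 : 0 ≤ sievedVonMangoldt ψ R (n + h₂) + errE χ ψ R R₀ x (n + h₂) +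
        errF ψ R R₀ Dr A x (n + h₂) + errG χ ψ R x (n + h₂) :=
      add_nonneg (add_nonneg (add_nonneg (sievedVonMangoldt_nonneg ψ R _) (errE_nonneg χ ψ R R₀ x _))
        (errF_nonneg _ _ _ _ _ _ _)) (errG_nonneg _ _ _ _ _)
    calc errE χ ψ R R₀ x (n + h₁) *
          (sievedVonMangoldt ψ R (n + h₂) + errE χ ψ R R₀ x (n + h₂) + errF ψ R R₀ Dr A x (n + h₂) +
            errG χ ψ R x (n + h₂))
        ≤ (cnt * (CL * W₁) * ν₁ * u) * (Ξ * W₂ * ν₂) :=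
          mul_le_mul hE₁ hsecond hsecond0 (by positivity)
      _ = CL * u * Ξ * (cnt * W₁ * W₂ * ν₁ * ν₂) := by ring
  -- sum and exchange
  have hswap : ∑ n ∈ Icc 1 x, ((∑ p ∈ excRange χ R₀ x, (if p ∣ n + h₁ then (1 : ℝ) else 0) +
        ∑ p ∈ sqRange R₀ x, (if p ^ 2 ∣ n + h₁ then (1 : ℝ) else 0)) *
        tauW Dr P (n + h₁) * tauW Dr P (n + h₂) * selbergSieve ψ R (n + h₁) * selbergSieve ψ R (n + h₂)) =
      ∑ p ∈ excRange χ R₀ x, aCorr ψ R Dr P h₁ h₂ x p + ∑ p ∈ sqRange R₀ x, aCorr ψ R Dr P h₁ h₂ x (p ^ 2) := by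
    have h1 : ∀ n : ℕ, ((∑ p ∈ excRange χ R₀ x, (if p ∣ n + h₁ then (1 : ℝ) else 0) +
        ∑ p ∈ sqRange R₀ x, (if p ^ 2 ∣ n + h₁ then (1 : ℝ) else 0)) *
        tauW Dr P (n + h₁) * tauW Dr P (n + h₂) * selbergSieve ψ R (n + h₁) * selbergSieve ψ R (n + h₂)) =
        ∑ p ∈ excRange χ R₀ x, (if p ∣ n + h₁ then (1 : ℝ) else 0) * tauW Dr P (n + h₁) * tauW Dr P (n + h₂) *
            selbergSieve ψ R (n + h₁) * selbergSieve ψ R (n + h₂) +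
          ∑ p ∈ sqRange R₀ x, (if p ^ 2 ∣ n + h₁ then (1 : ℝ) else 0) * tauW Dr P (n + h₁) * tauW Dr P (n + h₂) *
            selbergSieve ψ R (n + h₁) * selbergSieve ψ R (n + h₂) := by
      intro n
      rw [add_mul, add_mul, add_mul, add_mul, Finset.sum_mul, Finset.sum_mul, Finset.sum_mul, Finset.sum_mul,
        Finset.sum_mul, Finset.sum_mul, Finset.sum_mul, Finset.sum_mul]
    simp_rw [h1]
    rw [Finset.sum_add_distrib, Finset.sum_comm, Finset.sum_comm (s := Icc 1 x) (t := sqRange R₀ x)]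
    congr 1
    · exact Finset.sum_congr rfl fun p _ => sum_ind_mul_tauW_eq ψ R Dr P h₁ h₂ x p
    · exact Finset.sum_congr rfl fun p _ => sum_ind_mul_tauW_eq ψ R Dr P h₁ h₂ x (p ^ 2)
  calc ∑ n ∈ Icc 1 x, errE χ ψ R R₀ x (n + h₁) *
        (sievedVonMangoldt ψ R (n + h₂) + errE χ ψ R R₀ x (n + h₂) + errF ψ R R₀ Dr A x (n + h₂) +
          errG χ ψ R x (n + h₂))
      ≤ ∑ n ∈ Icc 1 x, CL * u * Ξ * ((∑ p ∈ excRange χ R₀ x, (if p ∣ n + h₁ then (1 : ℝ) else 0) +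
            ∑ p ∈ sqRange R₀ x, (if p ^ 2 ∣ n + h₁ then (1 : ℝ) else 0)) *
          tauW Dr P (n + h₁) * tauW Dr P (n + h₂) * selbergSieve ψ R (n + h₁) * selbergSieve ψ R (n + h₂)) :=
        Finset.sum_le_sum hpt
    _ = CL * u * Ξ * (∑ p ∈ excRange χ R₀ x, aCorr ψ R Dr P h₁ h₂ x p +
          ∑ p ∈ sqRange R₀ x, aCorr ψ R Dr P h₁ h₂ x (p ^ 2)) := by
        rw [← Finset.mul_sum, hswap]
    _ = _ := by rw [hΞ]


/-! ### Lemma 3.4 in the weighted form over an index set -/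

/-- Lemma 3.4 in the weighted form (`sieveCorrelation_weighted_le`) for a family of moduli indexed by
an arbitrary finite set (the moduli `([d,d₁], d₂)` of (5.7) need not be distinct): group the indices
by their modulus. [cite: TaoTeravainen2021, Lemma 3.4; §5 (proof of (5.7))] -/
theorem sieveCorrelation_weighted_le' {ψ : ℝ → ℝ} (hψ : IsSmoothCutoff ψ) {B : ℝ}
    (hB : ∀ u : ℝ, |ψ u| ≤ B) {h₁ h₂ : ℕ} (hne : h₁ ≠ h₂) {R : ℝ} (hR : 3 ≤ R) {ι : Type*}
    (I : Finset ι) (md : ι → (Fin 2 → ℕ)) (hI : ∀ i ∈ I, ∀ j, md i j ≠ 0) (a : ι → ℝ)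
    (ha : ∀ i ∈ I, 0 ≤ a i) {M : ℝ} {N : ℕ}
    (hM : ∀ σ : ℝ, 1 ≤ σ → ∑ i ∈ I, a i * gainWeight R (md i) σ ≤ M * σ ^ N) (x : ℕ) :
    ∑ i ∈ I, a i * sieveCorrelation ψ R h₁ h₂ (md i) x ≤
      x * (16 * kernelConst h₁ h₂ * M * momentConst ψ (216 + N) ^ 4 / Real.log R ^ 2) +
        (B * ⌈R⌉₊) ^ 4 * ∑ i ∈ I, a i := by
  classical
  set D := I.image md with hDdef
  set a' : (Fin 2 → ℕ) → ℝ := fun d => ∑ i ∈ I.filter (fun i => md i = d), a i with ha'def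
  -- regrouping identity
  have hgroup : ∀ F : (Fin 2 → ℕ) → ℝ, ∑ d ∈ D, a' d * F d = ∑ i ∈ I, a i * F (md i) := by
    intro F
    rw [← Finset.sum_fiberwise_of_maps_to (s := I) (t := D) (g := md)
      (fun i hi => Finset.mem_image_of_mem md hi) (fun i => a i * F (md i))]
    refine Finset.sum_congr rfl fun d _ => ?_
    rw [ha'def, Finset.sum_mul]
    refine Finset.sum_congr rfl fun i hi => ?_
    rw [(Finset.mem_filter.mp hi).2]
  have hD : ∀ d ∈ D, ∀ j, d j ≠ 0 := by
    intro d hd j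
    obtain ⟨i, hi, rfl⟩ := Finset.mem_image.mp hd
    exact hI i hi j
  have ha' : ∀ d ∈ D, 0 ≤ a' d := fun d _ => Finset.sum_nonneg fun i hi => ha i (Finset.mem_filter.mp hi).1
  have hM' : ∀ σ : ℝ, 1 ≤ σ → ∑ d ∈ D, a' d * gainWeight R d σ ≤ M * σ ^ N := by
    intro σ hσ
    rw [hgroup]
    exact hM σ hσ
  have h := sieveCorrelation_weighted_le hψ hB hne hR D hD a' ha' hM' x
  rw [hgroup] at h
  have hsum : ∑ d ∈ D, a' d = ∑ i ∈ I, a i := by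
    have := hgroup (fun _ => 1)
    simpa using this
  rwa [hsum] at h

/-! ### The size of the weights -/

/-- `∑_{d₁,d₂ ∈ T} τ(d₁)^P τ(d₂)^P ≤ C_τ^{2P} D^{5/2}` (divisor bound at exponent `1/(4(P+1))`).
[cite: TaoTeravainen2021, §5 (proof of (5.7): the error term `D^{k+1} R^{2k}/x`)] -/
theorem tau_sum_sq_le {Cτ : ℝ} (hCτ1 : 1 ≤ Cτ) {P : ℕ}
    (hτ : ∀ n : ℕ, n ≠ 0 → ((n.divisors.card : ℕ) : ℝ) ≤ Cτ * (n : ℝ) ^ (1 / (4 * ((P : ℝ) + 1))))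
    {Dr : ℝ} (hDr : 1 ≤ Dr) :
    ∑ dd ∈ fRange Dr ×ˢ fRange Dr, ((dd.1.divisors.card : ℕ) : ℝ) ^ P * ((dd.2.divisors.card : ℕ) : ℝ) ^ P ≤
      Cτ ^ (2 * P) * Dr ^ ((5 : ℝ) / 2) := by
  have hDr0 : 0 < Dr := by linarith
  have hw : ∀ d ∈ fRange Dr, ((d.divisors.card : ℕ) : ℝ) ^ P ≤ Cτ ^ P * Dr ^ ((1 : ℝ) / 4) := by
    intro d hd
    have hd1 : 1 ≤ d := (Finset.mem_Icc.mp hd).1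
    have hdD : (d : ℝ) ≤ Dr := le_trans (by exact_mod_cast (Finset.mem_Icc.mp hd).2) (Nat.floor_le hDr0.le)
    have hd0 : (1 : ℝ) ≤ d := by exact_mod_cast hd1
    have hτd := hτ d (by omega)
    calc ((d.divisors.card : ℕ) : ℝ) ^ P ≤ (Cτ * (d : ℝ) ^ (1 / (4 * ((P : ℝ) + 1)))) ^ P :=
          pow_le_pow_left₀ (Nat.cast_nonneg _) hτd P
      _ = Cτ ^ P * (d : ℝ) ^ ((P : ℝ) / (4 * ((P : ℝ) + 1))) := by
          rw [mul_pow, ← Real.rpow_natCast ((d : ℝ) ^ _), ← Real.rpow_mul (by positivity)]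
          congr 2
          ring
      _ ≤ Cτ ^ P * (d : ℝ) ^ ((1 : ℝ) / 4) := by
          refine mul_le_mul_of_nonneg_left (Real.rpow_le_rpow_of_exponent_le hd0 ?_) (by positivity)
          rw [div_le_div_iff₀ (by positivity) (by norm_num)]
          nlinarith
      _ ≤ Cτ ^ P * Dr ^ ((1 : ℝ) / 4) :=
          mul_le_mul_of_nonneg_left (Real.rpow_le_rpow (by positivity) hdD (by norm_num)) (by positivity)
  have hcard : ((fRange Dr).card : ℝ) ≤ Dr := by
    unfold fRange
    rw [Nat.card_Icc, Nat.add_sub_cancel]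
    exact Nat.floor_le hDr0.le
  have hT : ∑ d ∈ fRange Dr, ((d.divisors.card : ℕ) : ℝ) ^ P ≤ Dr * (Cτ ^ P * Dr ^ ((1 : ℝ) / 4)) := by
    calc ∑ d ∈ fRange Dr, ((d.divisors.card : ℕ) : ℝ) ^ P ≤ ∑ _d ∈ fRange Dr, Cτ ^ P * Dr ^ ((1 : ℝ) / 4) :=
          Finset.sum_le_sum hw
      _ = (fRange Dr).card * (Cτ ^ P * Dr ^ ((1 : ℝ) / 4)) := by rw [Finset.sum_const, nsmul_eq_mul]
      _ ≤ Dr * (Cτ ^ P * Dr ^ ((1 : ℝ) / 4)) := mul_le_mul_of_nonneg_right hcard (by positivity)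
  have hT0 : 0 ≤ ∑ d ∈ fRange Dr, ((d.divisors.card : ℕ) : ℝ) ^ P := Finset.sum_nonneg fun d _ => by positivity
  calc ∑ dd ∈ fRange Dr ×ˢ fRange Dr, ((dd.1.divisors.card : ℕ) : ℝ) ^ P * ((dd.2.divisors.card : ℕ) : ℝ) ^ P
      = (∑ d ∈ fRange Dr, ((d.divisors.card : ℕ) : ℝ) ^ P) * ∑ d ∈ fRange Dr, ((d.divisors.card : ℕ) : ℝ) ^ P := by
        rw [Finset.sum_mul_sum, Finset.sum_product]
    _ ≤ (Dr * (Cτ ^ P * Dr ^ ((1 : ℝ) / 4))) * (Dr * (Cτ ^ P * Dr ^ ((1 : ℝ) / 4))) :=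
        mul_le_mul hT hT hT0 (by positivity)
    _ = Cτ ^ (2 * P) * (Dr * Dr ^ ((1 : ℝ) / 4)) ^ 2 := by ring
    _ = Cτ ^ (2 * P) * Dr ^ ((5 : ℝ) / 2) := by
        congr 1
        rw [show Dr * Dr ^ ((1 : ℝ) / 4) = Dr ^ ((5 : ℝ) / 4) by
          rw [show (5 : ℝ) / 4 = 1 + 1 / 4 by norm_num, Real.rpow_add hDr0, Real.rpow_one]]
        rw [← Real.rpow_natCast, ← Real.rpow_mul hDr0.le]
        norm_num

/-! ### Small analytic inequalities -/

/-- `y^m ≤ m! e^y` for `y ≥ 0`. [folklore] -/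
theorem pow_le_factorial_mul_exp {y : ℝ} (hy : 0 ≤ y) (m : ℕ) : y ^ m ≤ m.factorial * Real.exp y := by
  have h := @Real.pow_div_factorial_le_exp y hy m
  have hf : (0 : ℝ) < m.factorial := by exact_mod_cast Nat.factorial_pos m
  rw [div_le_iff₀ hf] at h
  linarith

/-- `ℓ^{10m} e^{-ℓ^{10}/c} ≤ c^m m!` for `c > 0`. [folklore] -/
theorem pow_mul_exp_neg_le (ℓ : ℝ) {c : ℝ} (hc : 0 < c) (m : ℕ) :
    ℓ ^ (10 * m) * Real.exp (-(ℓ ^ 10 / c)) ≤ c ^ m * m.factorial := by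
  have h := pow_le_factorial_mul_exp (by positivity : 0 ≤ ℓ ^ 10 / c) m
  rw [div_pow, div_le_iff₀ (by positivity)] at h
  rw [pow_mul, Real.exp_neg]
  have he : 0 < Real.exp (ℓ ^ 10 / c) := Real.exp_pos _
  rw [mul_inv_le_iff₀ he]
  calc (ℓ ^ 10) ^ m ≤ m.factorial * Real.exp (ℓ ^ 10 / c) * c ^ m := h
    _ = c ^ m * m.factorial * Real.exp (ℓ ^ 10 / c) := by ring

/-- `u² ≤ 512 e^{u/16}` for `u ≥ 0`. [folklore] -/
theorem sq_le_exp_sixteenth {u : ℝ} (hu : 0 ≤ u) : u ^ 2 ≤ 512 * Real.exp (u / 16) := by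
  have h := @Real.pow_div_factorial_le_exp (u / 16) (by positivity) 2
  rw [Nat.factorial_two] at h
  push_cast at h
  rw [div_le_iff₀ (by norm_num : (0 : ℝ) < 2)] at h
  nlinarith

/-- `ℓ^{11} ≤ e^{3u/16}` when `ℓ ≥ 2` and `ℓ^{10} ≤ u`. [folklore] -/
theorem pow_eleven_le_exp {ℓ u : ℝ} (hℓ : 2 ≤ ℓ) (hu : ℓ ^ 10 ≤ u) : ℓ ^ 11 ≤ Real.exp (3 * u / 16) := by
  have hℓ0 : 0 < ℓ := by linarith
  have h1 : Real.log ℓ ≤ ℓ := (Real.log_le_sub_one_of_pos hℓ0).trans (by linarith)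
  have h2 : 59 * ℓ ≤ ℓ ^ 10 := by
    have : (2 : ℝ) ^ 9 ≤ ℓ ^ 9 := pow_le_pow_left₀ (by norm_num) hℓ 9
    nlinarith
  have h3 : 11 * Real.log ℓ ≤ 3 * u / 16 := by nlinarith
  calc ℓ ^ 11 = Real.exp (Real.log (ℓ ^ 11)) := (Real.exp_log (by positivity)).symm
    _ = Real.exp (11 * Real.log ℓ) := by rw [Real.log_pow]; norm_num
    _ ≤ Real.exp (3 * u / 16) := Real.exp_le_exp.mpr h3


/-- The exceptional primes of `excRange` are among those of Corollary 3.6 (i) (`R₀ < p* ≤ √(2x) ≤ x`).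
[cite: TaoTeravainen2021, Corollary 3.6, (2.5)] -/
theorem sum_inv_excRange_le {x : ℕ} (hx : 2 ≤ x) (R₀ : ℝ) :
    ∑ p ∈ excRange χ R₀ x, (1 : ℝ) / p ≤
      ∑ p ∈ Literature.NumberTheory.LFunctions.SiegelZero.excPrimes χ (Icc ⌈R₀⌉₊ ⌊(x : ℝ)⌋₊), (1 : ℝ) / p := by
  have hx2 : (2 : ℝ) ≤ x := by exact_mod_cast hx
  have hsqrt : Real.sqrt (2 * x) ≤ x := by
    rw [Real.sqrt_le_left (by linarith)]
    nlinarith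
  refine Finset.sum_le_sum_of_subset_of_nonneg (fun p hp => ?_) fun _ _ _ => by positivity
  unfold excRange at hp
  rw [Finset.mem_filter, Finset.mem_range] at hp
  obtain ⟨-, hpp, hre, hR₀, hsq⟩ := hp
  rw [Literature.NumberTheory.LFunctions.SiegelZero.mem_excPrimes, Finset.mem_Icc, Nat.floor_natCast]
  refine ⟨⟨Nat.ceil_le.mpr hR₀.le, ?_⟩, hpp, fun h => hre ?_⟩
  · exact_mod_cast hsq.trans hsqrt
  · simp [realChar, h]

/-- `∑_{p₀ ∈ sqRange} 1/p₀² ≤ 2/R₀` (`R₀ > 0`; `∑_{n > k} 1/n² ≤ 2/(k+1)`). [folklore] -/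
theorem sum_inv_sq_sqRange_le {R₀ : ℝ} (hR₀ : 0 < R₀) (x : ℕ) :
    ∑ p ∈ sqRange R₀ x, (1 : ℝ) / (p : ℝ) ^ 2 ≤ 2 / R₀ := by
  have h := sum_Ioo_inv_sq_le (α := ℝ) ⌊R₀⌋₊ (2 * x + 1)
  have hsub : sqRange R₀ x ⊆ Finset.Ioo ⌊R₀⌋₊ (2 * x + 1) := by
    intro p hp
    unfold sqRange at hp
    rw [Finset.mem_filter, Finset.mem_range] at hp
    rw [Finset.mem_Ioo]
    refine ⟨?_, hp.1⟩
    have : (⌊R₀⌋₊ : ℝ) < p := lt_of_le_of_lt (Nat.floor_le hR₀.le) hp.2.2.1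
    exact_mod_cast this
  have hfl : R₀ ≤ (⌊R₀⌋₊ : ℝ) + 1 := (Nat.lt_floor_add_one R₀).le
  calc ∑ p ∈ sqRange R₀ x, (1 : ℝ) / (p : ℝ) ^ 2 ≤ ∑ p ∈ Finset.Ioo ⌊R₀⌋₊ (2 * x + 1), (1 : ℝ) / (p : ℝ) ^ 2 :=
        Finset.sum_le_sum_of_subset_of_nonneg hsub fun _ _ _ => by positivity
    _ = ∑ p ∈ Finset.Ioo ⌊R₀⌋₊ (2 * x + 1), ((p : ℝ) ^ 2)⁻¹ := Finset.sum_congr rfl fun _ _ => one_div _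
    _ ≤ 2 / ((⌊R₀⌋₊ : ℝ) + 1) := h
    _ ≤ 2 / R₀ := div_le_div_of_nonneg_left (by norm_num) hR₀ hfl

/-- The index sets have at most `3√x` elements (`x ≥ 1`). [folklore] -/
theorem card_sqRange_le {x : ℕ} (hx : 1 ≤ x) (s : Finset ℕ)
    (hs : s ⊆ (Finset.range (2 * x + 1)).filter fun p : ℕ => (p : ℝ) ≤ Real.sqrt (2 * x)) :
    (s.card : ℝ) ≤ 3 * Real.sqrt x := by
  have hx1 : (1 : ℝ) ≤ x := by exact_mod_cast hx
  have hsx : 1 ≤ Real.sqrt x := by rw [Real.le_sqrt' one_pos]; simpa using hx1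
  have hsub : s ⊆ Finset.range (⌊Real.sqrt (2 * x)⌋₊ + 1) := by
    intro p hp
    have := (Finset.mem_filter.mp (hs hp)).2
    rw [Finset.mem_range, Nat.lt_succ_iff]
    exact Nat.le_floor this
  have h2 : Real.sqrt (2 * x) = Real.sqrt 2 * Real.sqrt x := Real.sqrt_mul (by norm_num) _
  have hs2 : Real.sqrt 2 ≤ 2 := by
    rw [Real.sqrt_le_left (by norm_num)]; norm_num
  calc (s.card : ℝ) ≤ ((Finset.range (⌊Real.sqrt (2 * x)⌋₊ + 1)).card : ℝ) := by
        exact_mod_cast Finset.card_le_card hsub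
    _ = (⌊Real.sqrt (2 * x)⌋₊ : ℝ) + 1 := by rw [Finset.card_range]; push_cast; ring
    _ ≤ Real.sqrt (2 * x) + 1 := by linarith [Nat.floor_le (Real.sqrt_nonneg (2 * (x : ℝ)))]
    _ = Real.sqrt 2 * Real.sqrt x + 1 := by rw [h2]
    _ ≤ 2 * Real.sqrt x + Real.sqrt x := by nlinarith
    _ = 3 * Real.sqrt x := by ring

/-- `excRange` sits inside the `√(2x)`-box. [folklore] -/
theorem excRange_subset (R₀ : ℝ) (x : ℕ) :
    excRange χ R₀ x ⊆ (Finset.range (2 * x + 1)).filter fun p : ℕ => (p : ℝ) ≤ Real.sqrt (2 * x) := by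
  intro p hp
  unfold excRange at hp
  rw [Finset.mem_filter] at hp ⊢
  exact ⟨hp.1, hp.2.2.2.2⟩

/-- `sqRange` sits inside the `√(2x)`-box. [folklore] -/
theorem sqRange_subset (R₀ : ℝ) (x : ℕ) :
    sqRange R₀ x ⊆ (Finset.range (2 * x + 1)).filter fun p : ℕ => (p : ℝ) ≤ Real.sqrt (2 * x) := by
  intro p hp
  unfold sqRange at hp
  rw [Finset.mem_filter] at hp ⊢
  exact ⟨hp.1, hp.2.2.2⟩


/-- The per-modulus bound from Lemma 3.4: for a prime `p₀`, `j`, and the data of the assembly,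
`a_{p₀^j} ≤ x · 16 C_K (1944/p₀^j · Γ) J⁴/log² R + (B⌈R⌉)⁴ ∑ τ^Pτ^P`. [cite: TaoTeravainen2021, §5 (proof of (5.7): "Applying Lemma 3.4 …")] -/
theorem aCorr_le {ψ : ℝ → ℝ} (hψ : IsSmoothCutoff ψ) {B : ℝ} (hB : ∀ u : ℝ, |ψ u| ≤ B) {h₁ h₂ : ℕ}
    (hne : h₁ ≠ h₂) {R : ℝ} (hR : 3 ≤ R) {Dr : ℝ} (hM' : 2 ≤ ⌊Dr⌋₊) (P : ℕ) {p₀ : ℕ} (hp : p₀.Prime)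
    (j x : ℕ) :
    aCorr ψ R Dr P h₁ h₂ x (p₀ ^ j) ≤
      x * (16 * kernelConst h₁ h₂ * (1944 / (p₀ : ℝ) ^ j * (2 ^ j * (1 + cA P / 2) ^ 2 *
        ((max 1 (Real.log (⌊Dr⌋₊ : ℕ) / Real.log R)) ^ expN' P * Real.exp (25 * expN' P) *
          2 ^ (40 * expN' P)))) * momentConst ψ (216 + 40 * expN' P) ^ 4 / Real.log R ^ 2) +
        (B * ⌈R⌉₊) ^ 4 * ∑ dd ∈ fRange Dr ×ˢ fRange Dr,
          ((dd.1.divisors.card : ℕ) : ℝ) ^ P * ((dd.2.divisors.card : ℕ) : ℝ) ^ P := by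
  classical
  have hpj : p₀ ^ j ≠ 0 := pow_ne_zero _ hp.ne_zero
  have h := sieveCorrelation_weighted_le' hψ hB hne hR (fRange Dr ×ˢ fRange Dr)
    (fun dd => ![Nat.lcm (p₀ ^ j) dd.1, dd.2]) (by
      intro dd hdd k
      rw [Finset.mem_product] at hdd
      have h1 : 1 ≤ dd.1 := (Finset.mem_Icc.mp hdd.1).1
      have h2 : 1 ≤ dd.2 := (Finset.mem_Icc.mp hdd.2).1
      fin_cases k
      · simpa using Nat.lcm_ne_zero hpj (by omega)
      · simp; omega)
    (fun dd => ((dd.1.divisors.card : ℕ) : ℝ) ^ P * ((dd.2.divisors.card : ℕ) : ℝ) ^ P)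
    (fun dd _ => by positivity) (fun σ hσ => tau_gain_lcm_sum_le hR hM' P hp j hσ) x
  unfold aCorr
  rw [← Finset.sum_product']
  exact h

end TaoTeravainen

set_option maxHeartbeats 4000000 in
open TaoTeravainen in
/-- **Tao–Teräväinen 2022, (5.7) for `k = 2`, `ℓ = 0` — PROVED** (`TaoTeravainen2021_eq57_pair`):
"`𝔼_{n ≤ x} E(n+h₁) ∏_{j=2}^k (Λν + E + F + G)(n+h_j) ≈ 0`". Proof as printed: Landreau's inequality
(3.10) bounds every factor by `(∑_{d ≤ D, d∣·} τ(d)^{O(1)}) ν log x` (`sum_errE_mul_le`), reducing to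
`(log² x)(∑_{R₀<p*≤√(2x)} a_{p*} + ∑_{R₀<p₀≤√(2x)} a_{p₀²})`; Lemma 3.4 with the Euler product bound with
the distinguished prime `p₀` (`aCorr_le`: `a_d ≪ τ(d)^{O(1)} log_R^{O(1)} x/(d log² R) + D^{5/2} R⁴/x`);
then Corollary 3.6 (i) (`∑ 1/p* ≤ K e^{-√(log η)/2}`), `∑_{p₀ > R₀} 1/p₀² ≤ 2/R₀`, the scales (2.3)–(2.5)
and Siegel's bound (1.4). All losses are powers of `log_R x = log^{1/10} η` and of `log x/log R₀ = √(log η)`,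
beaten by the savings `e^{-√(log η)/2}` and `1/R₀`.
[cite: TaoTeravainen2021, §5, proof of Proposition 5.2, (5.7); Lemma 3.1 (ii), (3.10); Lemma 3.4; (2.11), (3.3); Corollary 3.6; (2.3)–(2.6); (1.4)] -/
theorem TaoTeravainen2021_eq57_pair_holds : TaoTeravainen2021_eq57_pair := by
  intro h₁ h₂ hh₁ hh₂ hne ψ hψ
  refine ⟨1, one_pos, fun ε₀ hε₀ hε₀1 A => ?_⟩
  classical
  obtain ⟨B, hB0, hB⟩ := hψ.exists_abs_le
  obtain ⟨CS, hCS, hSiegel⟩ := exists_siegelZero_quality_le one_pos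
  have hε40 : (0 : ℝ) < ε₀ / 40 := by positivity
  obtain ⟨CL, hCL, ML, hLand⟩ := Literature.NumberTheory.Sieve.Landreau.card_divisors_le_sum_of_le hε40
  set P : ℕ := max ML A with hPdef
  have hεP : (0 : ℝ) < 1 / (4 * ((P : ℝ) + 1)) := by positivity
  obtain ⟨Cτ, hCτ1, hτ⟩ := Literature.NumberTheory.Sieve.exists_card_divisors_le_mul_rpow hεP
  obtain ⟨K₃₆, η₀, h36⟩ :=
    Literature.NumberTheory.LFunctions.SiegelZero.TaoTeravainen2021_cor36_i_holds 1 one_pos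
  -- constants
  set N' : ℕ := expN' P with hN'def
  set CK : ℝ := kernelConst h₁ h₂ with hCKdef
  set J : ℝ := momentConst ψ (216 + 40 * N') with hJdef
  set Γ₀ : ℝ := 4 * (1 + cA P / 2) ^ 2 * Real.exp (25 * N') * 2 ^ (40 * N') with hΓ₀def
  set cS : ℝ := 1 + |Real.log CS| with hcSdef
  set K' : ℝ := max K₃₆ 0 with hK'def
  set Cred : ℝ := CL * (5 + 4 * CL) with hCreddef
  set Fac : ℝ := ((N' + 2).factorial : ℝ) with hFacdef
  set Cmain : ℝ := Cred * (16 * CK * J ^ 4) * 1944 * Γ₀ *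
    (K' * (2 ^ (N' + 2) * Fac) + 2 * (cS ^ (N' + 2) * Fac)) with hCmaindef
  set Cerr : ℝ := Cred * 6 * (16 * B ^ 4) * Cτ ^ (2 * P) * 512 with hCerrdef
  set M₀ : ℝ := 10 * cS + 10 + 20 / ε₀ with hM₀def
  have hCK0 : 0 < CK := kernelConst_pos hne
  have hJ0 : 0 ≤ J := momentConst_nonneg ψ _
  have hcA := cA_pos P
  have hΓ₀0 : 0 < Γ₀ := by positivity
  have hcS1 : 1 ≤ cS := by
    have := abs_nonneg (Real.log CS); rw [hcSdef]; linarith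
  have hcS0 : 0 < cS := by linarith
  have hK'0 : 0 ≤ K' := le_max_right _ _
  have hCred0 : 0 < Cred := by positivity
  have hFac0 : 0 < Fac := by rw [hFacdef]; exact_mod_cast Nat.factorial_pos _
  have hCmain0 : 0 ≤ Cmain := by positivity
  have hCerr0 : 0 ≤ Cerr := by positivity
  have h20ε : 0 < 20 / ε₀ := by positivity
  have hM₀10 : 10 ≤ M₀ := by rw [hM₀def]; linarith
  have hM₀0 : 0 ≤ M₀ := by linarith
  refine ⟨Cmain + Cerr, max (max η₀ (Real.exp 1024)) (max (Real.exp (M₀ ^ 20)) (CS * max h₁ h₂)), ?_⟩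
  intro q _ χ η hS hη x hxlo hxhi
  -- thresholds
  have hη₀ : η₀ ≤ η := le_trans ((le_max_left _ _).trans (le_max_left _ _)) hη
  have hη1024 : Real.exp 1024 ≤ η := le_trans ((le_max_right _ _).trans (le_max_left _ _)) hη
  have hηM : Real.exp (M₀ ^ 20) ≤ η := le_trans ((le_max_left _ _).trans (le_max_right _ _)) hη
  have hηh : CS * ((max h₁ h₂ : ℕ) : ℝ) ≤ η := le_trans ((le_max_right _ _).trans (le_max_right _ _)) hη
  -- sizes of `η`, `q`, `x`
  have hη0 : 0 < η := (Real.exp_pos _).trans_le hη1024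
  have hlogη : 1024 ≤ Real.log η := by
    rw [← Real.log_exp 1024]; exact Real.log_le_log (Real.exp_pos _) hη1024
  have hlogη0 : 0 < Real.log η := by linarith
  have hq3 : (3 : ℝ) ≤ q := by exact_mod_cast hS.three_le
  have hqx : (q : ℝ) ≤ x :=
    calc (q : ℝ) = (q : ℝ) ^ (1 : ℝ) := (Real.rpow_one _).symm
      _ ≤ (q : ℝ) ^ ((41 : ℝ) / 2 + ε₀) := Real.rpow_le_rpow_of_exponent_le (by linarith) (by linarith)
      _ ≤ x := hxlo
  have hx3 : (3 : ℝ) ≤ x := hq3.trans hqx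
  have hx1 : (1 : ℝ) ≤ x := by linarith
  have hx0 : (0 : ℝ) < x := by linarith
  have hx2 : 2 ≤ x := by exact_mod_cast (show (2 : ℝ) ≤ x by linarith)
  have hx2r : (2 : ℝ) ≤ x := by linarith
  have hηx : η ≤ CS * x := by
    have h1 := hSiegel q χ η hS
    rw [Real.rpow_one] at h1
    exact h1.trans (mul_le_mul_of_nonneg_left hqx hCS.le)
  have hhx : ((max h₁ h₂ : ℕ) : ℝ) ≤ x := le_of_mul_le_mul_left (hηh.trans hηx) hCS
  have hhx' : max h₁ h₂ ≤ x := by exact_mod_cast hhx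
  have hh₁x : h₁ ≤ x := (le_max_left h₁ h₂).trans hhx'
  have hh₂x : h₂ ≤ x := (le_max_right h₁ h₂).trans hhx'
  -- `u = log x`, `ℓ = log^{1/20} η ≥ M₀`
  set u : ℝ := Real.log x with hudef
  have hu1 : 1 ≤ u := (Real.le_log_iff_exp_le hx0).mpr (by linarith [Real.exp_one_lt_d9])
  have hu0 : 0 < u := by linarith
  have hxu : Real.exp u = x := by rw [hudef, Real.exp_log hx0]
  set ℓ : ℝ := Real.log η ^ ((1 : ℝ) / 20) with hℓdef
  have hℓ0 : 0 < ℓ := Real.rpow_pos_of_pos hlogη0 _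
  have hℓ20 : ℓ ^ 20 = Real.log η := by
    rw [hℓdef, ← Real.rpow_natCast, ← Real.rpow_mul hlogη0.le]; norm_num
  have hℓ2 : ℓ ^ 2 = Real.log η ^ ((1 : ℝ) / 10) := by
    rw [hℓdef, ← Real.rpow_natCast, ← Real.rpow_mul hlogη0.le]; norm_num
  have hℓ10 : ℓ ^ 10 = Real.sqrt (Real.log η) := by
    rw [hℓdef, ← Real.rpow_natCast, ← Real.rpow_mul hlogη0.le, Real.sqrt_eq_rpow]; norm_num
  have hℓM : M₀ ≤ ℓ := by
    have h1 : M₀ ^ 20 ≤ Real.log η := by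
      rw [← Real.log_exp (M₀ ^ 20)]; exact Real.log_le_log (Real.exp_pos _) hηM
    have h2 : (M₀ ^ 20) ^ ((1 : ℝ) / 20) ≤ ℓ := Real.rpow_le_rpow (by positivity) h1 (by norm_num)
    rwa [← Real.rpow_natCast, ← Real.rpow_mul hM₀0, show ((20 : ℕ) : ℝ) * (1 / 20) = 1 by norm_num,
      Real.rpow_one] at h2
  have hℓ1 : 1 ≤ ℓ := by linarith
  have hℓ6 : 6 ≤ ℓ := by linarith
  have hℓ2' : 2 ≤ ℓ := by linarith
  have hℓε : 20 / ε₀ ≤ ℓ := by rw [hM₀def] at hℓM; linarith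
  -- `log η ≤ c_S u`
  have hlogη_le : Real.log η ≤ cS * u := by
    have h1 : Real.log η ≤ Real.log CS + u := by
      rw [hudef, ← Real.log_mul hCS.ne' hx0.ne']; exact Real.log_le_log hη0 hηx
    have h2 : Real.log CS ≤ |Real.log CS| * u :=
      (le_abs_self _).trans (le_mul_of_one_le_right (abs_nonneg _) hu1)
    rw [hcSdef]; linarith
  -- `R = e^t`, `t = u/ℓ²`
  set R : ℝ := pairScaleR η x with hRdef
  set t : ℝ := u / ℓ ^ 2 with htdef
  have hℓ2pos : 0 < ℓ ^ 2 := by positivity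
  have ht0 : 0 < t := div_pos hu0 hℓ2pos
  have hut : u = t * ℓ ^ 2 := by rw [htdef]; field_simp
  have hRexp : R = Real.exp t := by
    rw [hRdef]; unfold pairScaleR
    rw [← hℓ2, Real.rpow_def_of_pos hx0, htdef, hudef]; congr 1; ring
  have hlogR : Real.log R = t := by rw [hRexp, Real.log_exp]
  have huℓ : ℓ ^ 10 ≤ u := by
    have h1 : ℓ ^ 20 ≤ cS * u := hℓ20 ▸ hlogη_le
    have h2 : cS ≤ ℓ ^ 10 := by
      have : cS ≤ ℓ := by rw [hM₀def] at hℓM; linarith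
      exact this.trans (le_self_pow₀ hℓ1 (by norm_num))
    have h3 : ℓ ^ 10 * ℓ ^ 10 ≤ cS * u := by rw [← pow_add]; exact h1
    have h4 : cS * u ≤ ℓ ^ 10 * u := mul_le_mul_of_nonneg_right h2 hu0.le
    have h5 : ℓ ^ 10 * ℓ ^ 10 ≤ ℓ ^ 10 * u := h3.trans h4
    exact le_of_mul_le_mul_left h5 (pow_pos hℓ0 10)
  have huℓcS : ℓ ^ 10 / cS ≤ u / ℓ ^ 10 := by
    have hℓ10pos : 0 < ℓ ^ 10 := by positivity
    rw [div_le_div_iff₀ hcS0 hℓ10pos, ← pow_add]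
    have : ℓ ^ (10 + 10) = ℓ ^ 20 := by norm_num
    rw [this, hℓ20, mul_comm]
    exact hlogη_le
  have ht_ge : ℓ ^ 18 ≤ cS * t := by
    have h1 : ℓ ^ 18 * ℓ ^ 2 ≤ cS * t * ℓ ^ 2 := by
      have : ℓ ^ 18 * ℓ ^ 2 = Real.log η := by rw [← hℓ20]; ring
      rw [this, mul_assoc, ← hut]; exact hlogη_le
    exact le_of_mul_le_mul_right h1 hℓ2pos
  have ht10 : 10 ≤ t := by
    have hℓ18 : ℓ ≤ ℓ ^ 18 := le_self_pow₀ hℓ1 (by norm_num)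
    have h1 : cS * 10 ≤ cS * t := by
      have : 10 * cS ≤ ℓ := by rw [hM₀def] at hℓM; linarith
      linarith
    exact le_of_mul_le_mul_left h1 hcS0
  have hR3 : 3 ≤ R := by rw [hRexp]; linarith [Real.add_one_le_exp t]
  have hR1 : 1 < R := by linarith
  have hR0 : 0 < R := by linarith
  have hRsqrt : R ≤ Real.sqrt x := pairScaleR_le_sqrt hη1024 hx1
  -- `R₀ = e^{u/ℓ^{10}}`
  set R₀ : ℝ := scaleR0 η x with hR₀def
  have hℓ10pos : 0 < ℓ ^ 10 := by positivity
  have hR₀exp : R₀ = Real.exp (u / ℓ ^ 10) := by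
    rw [hR₀def]; unfold scaleR0
    rw [← hℓ10, Real.rpow_def_of_pos hx0, hudef]; congr 1; ring
  have hR₀pos : 0 < R₀ := by rw [hR₀exp]; exact Real.exp_pos _
  have hR₀1 : 1 < R₀ := by
    rw [hR₀exp]
    have : 0 < u / ℓ ^ 10 := div_pos hu0 hℓ10pos
    linarith [Real.add_one_le_exp (u / ℓ ^ 10)]
  have hlogR₀ : Real.log R₀ = u / ℓ ^ 10 := by rw [hR₀exp, Real.log_exp]
  -- `D = e^{ε₀u/20}`, `⌊D⌋ ≥ 2`
  set Dr : ℝ := scaleD 2 ε₀ x with hDrdef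
  have hDrexp : Dr = Real.exp (u * (ε₀ / 20)) := by
    rw [hDrdef]; unfold scaleD
    rw [Real.rpow_def_of_pos hx0, hudef]; congr 1; ring
  have hDr1 : 1 ≤ Dr := by rw [hDrexp]; exact Real.one_le_exp (by positivity)
  have hDr0 : 0 < Dr := by linarith
  have hDr2 : (2 : ℝ) ≤ Dr := by
    have hℓu : ℓ ≤ u := le_trans (le_self_pow₀ hℓ1 (by norm_num)) huℓ
    have h1 : 1 ≤ u * (ε₀ / 20) := by
      have : 20 / ε₀ ≤ u := hℓε.trans hℓu
      rw [div_le_iff₀ hε₀] at this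
      have e : u * (ε₀ / 20) = u * ε₀ / 20 := by ring
      rw [e, le_div_iff₀ (by norm_num : (0:ℝ) < 20)]
      linarith
    rw [hDrexp]; linarith [Real.add_one_le_exp (u * (ε₀ / 20))]
  have hM'2 : 2 ≤ ⌊Dr⌋₊ := Nat.le_floor (by exact_mod_cast hDr2)
  have hDr52 : Dr ^ ((5 : ℝ) / 2) ≤ Real.exp (u / 8) := by
    rw [hDrexp, ← Real.exp_mul, Real.exp_le_exp]
    have := mul_le_mul_of_nonneg_left hε₀1 hu0.le
    linarith
  have hlogDr : Real.log (⌊Dr⌋₊ : ℕ) / Real.log R ≤ ℓ ^ 2 := by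
    have h1 : Real.log (⌊Dr⌋₊ : ℕ) ≤ u * (ε₀ / 20) := by
      calc Real.log (⌊Dr⌋₊ : ℕ) ≤ Real.log Dr :=
            Real.log_le_log (by exact_mod_cast (show 0 < ⌊Dr⌋₊ by omega)) (Nat.floor_le hDr0.le)
        _ = u * (ε₀ / 20) := by rw [hDrexp, Real.log_exp]
    rw [hlogR, div_le_iff₀ ht0]
    calc Real.log (⌊Dr⌋₊ : ℕ) ≤ u * (ε₀ / 20) := h1
      _ ≤ u * 1 := by gcongr; linarith
      _ = ℓ ^ 2 * t := by rw [hut]; ring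
  have hℓD : max 1 (Real.log (⌊Dr⌋₊ : ℕ) / Real.log R) ≤ ℓ ^ 2 :=
    max_le (one_le_pow₀ hℓ1) hlogDr
  have hℓD0 : 0 ≤ max 1 (Real.log (⌊Dr⌋₊ : ℕ) / Real.log R) := le_trans zero_le_one (le_max_left _ _)
  -- Landreau's inequality at `X = 2x`, `y = (2x)^{ε₀/40} ≤ D`
  have hy : (2 * (x : ℝ)) ^ (ε₀ / 40) ≤ Dr := by
    have h1 : (2 * (x : ℝ)) ≤ (x : ℝ) ^ (2 : ℕ) := by
      rw [pow_two]; exact mul_le_mul_of_nonneg_right hx2r hx0.le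
    calc (2 * (x : ℝ)) ^ (ε₀ / 40) ≤ ((x : ℝ) ^ (2 : ℕ)) ^ (ε₀ / 40) :=
          Real.rpow_le_rpow (by positivity) h1 (by positivity)
      _ = (x : ℝ) ^ (ε₀ / (10 * (2 : ℕ))) := by
          rw [← Real.rpow_natCast, ← Real.rpow_mul hx0.le]; congr 1; push_cast; ring
      _ = Dr := by rw [hDrdef]; rfl
  have hLand' : ∀ n : ℕ, n ≠ 0 → (n : ℝ) ≤ 2 * x → (n.divisors.card : ℝ) ≤
      CL * ∑ d ∈ n.divisors, (if (d : ℝ) ≤ (2 * (x : ℝ)) ^ (ε₀ / 40) then ((d.divisors.card : ℕ) : ℝ) ^ ML else 0) :=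
    fun n hn hnx => hLand (2 * x) n hn hnx
  -- Step 1: the reduction
  have hred := sum_errE_mul_le χ hψ hR1 hRsqrt hh₁x hh₂x hx2 hR₀1 hDr1 (A := A) (P := P) (le_max_right _ _)
    hCL (ML := ML) (le_max_left _ _) hy hLand'
  set L₂ : ℝ := Real.log (2 * x) with hL₂def
  have hL₂ : L₂ ≤ 2 * u := by
    rw [hL₂def, hudef, Real.log_mul (by norm_num) hx0.ne']
    have : Real.log 2 ≤ Real.log x := Real.log_le_log (by norm_num) hx2r
    linarith
  have hL₂0 : 0 ≤ L₂ := Real.log_nonneg (by linarith)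
  have hΞ : CL * u * (2 * L₂ + 2 * L₂ * CL * u / Real.log R₀ + u) ≤ Cred * u ^ 2 * ℓ ^ 10 := by
    rw [hlogR₀]
    have h1 : 2 * L₂ * CL * u / (u / ℓ ^ 10) = 2 * L₂ * CL * ℓ ^ 10 := by
      field_simp
    rw [h1]
    have hℓ10one : 1 ≤ ℓ ^ 10 := one_le_pow₀ hℓ1
    have h2 : 2 * L₂ + 2 * L₂ * CL * ℓ ^ 10 + u ≤ (5 + 4 * CL) * u * ℓ ^ 10 := by
      have e3 : u ≤ u * ℓ ^ 10 := le_mul_of_one_le_right hu0.le hℓ10one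
      have e1 : 2 * L₂ ≤ 4 * u * ℓ ^ 10 := by linarith
      have e2 : 2 * L₂ * CL * ℓ ^ 10 ≤ 4 * u * CL * ℓ ^ 10 := by
        have := mul_le_mul_of_nonneg_right hL₂ (by positivity : 0 ≤ CL * ℓ ^ 10)
        linarith
      linarith
    calc CL * u * (2 * L₂ + 2 * L₂ * CL * ℓ ^ 10 + u) ≤ CL * u * ((5 + 4 * CL) * u * ℓ ^ 10) :=
          mul_le_mul_of_nonneg_left h2 (by positivity)
      _ = Cred * u ^ 2 * ℓ ^ 10 := by rw [hCreddef]; ring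
  -- Step 2: the per-modulus bounds
  have hτsum0 : 0 ≤ ∑ dd ∈ fRange Dr ×ˢ fRange Dr,
      ((dd.1.divisors.card : ℕ) : ℝ) ^ P * ((dd.2.divisors.card : ℕ) : ℝ) ^ P :=
    Finset.sum_nonneg fun _ _ => mul_nonneg (pow_nonneg (Nat.cast_nonneg _) _) (pow_nonneg (Nat.cast_nonneg _) _)
  obtain ⟨E, hEdef⟩ : ∃ E : ℝ, E = (B * ⌈R⌉₊) ^ 4 * ∑ dd ∈ fRange Dr ×ˢ fRange Dr,
      ((dd.1.divisors.card : ℕ) : ℝ) ^ P * ((dd.2.divisors.card : ℕ) : ℝ) ^ P := ⟨_, rfl⟩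
  have hE0 : 0 ≤ E := by rw [hEdef]; exact mul_nonneg (by positivity) hτsum0
  set ℓD : ℝ := max 1 (Real.log (⌊Dr⌋₊ : ℕ) / Real.log R) with hℓDdef
  set Γ : ℕ → ℝ := fun j => 2 ^ j * (1 + cA P / 2) ^ 2 * (ℓD ^ N' * Real.exp (25 * N') * 2 ^ (40 * N'))
    with hΓdef
  have hΓle : ∀ j ≤ 2, Γ j ≤ Γ₀ * ℓ ^ (2 * N') := by
    intro j hj
    simp only [hΓdef, hΓ₀def]
    have h2j : (2 : ℝ) ^ j ≤ 4 := by
      calc (2 : ℝ) ^ j ≤ 2 ^ 2 := pow_le_pow_right₀ (by norm_num) hj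
        _ = 4 := by norm_num
    have hℓDN : ℓD ^ N' ≤ ℓ ^ (2 * N') := by rw [pow_mul]; exact pow_le_pow_left₀ hℓD0 hℓD N'
    have h0 : 0 ≤ (1 + cA P / 2) ^ 2 * (Real.exp (25 * N') * 2 ^ (40 * N')) := by positivity
    calc (2 : ℝ) ^ j * (1 + cA P / 2) ^ 2 * (ℓD ^ N' * Real.exp (25 * N') * 2 ^ (40 * N'))
        = (2 : ℝ) ^ j * ℓD ^ N' * ((1 + cA P / 2) ^ 2 * (Real.exp (25 * N') * 2 ^ (40 * N'))) := by ring
      _ ≤ 4 * ℓ ^ (2 * N') * ((1 + cA P / 2) ^ 2 * (Real.exp (25 * N') * 2 ^ (40 * N'))) :=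
          mul_le_mul_of_nonneg_right (mul_le_mul h2j hℓDN (by positivity) (by norm_num)) h0
      _ = _ := by ring
  have hΓ0 : ∀ j, 0 ≤ Γ j := fun j => by simp only [hΓdef]; positivity
  set Lam : ℝ := 16 * CK * J ^ 4 / t ^ 2 with hLamdef
  have hLam0 : 0 ≤ Lam := by positivity
  have hper : ∀ {p₀ : ℕ}, p₀.Prime → ∀ j : ℕ, aCorr ψ R Dr P h₁ h₂ x (p₀ ^ j) ≤
      x * Lam * (1944 / (p₀ : ℝ) ^ j * Γ j) + E := by
    intro p₀ hp j
    have h := aCorr_le hψ hB hne hR3 hM'2 P hp j x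
    refine h.trans (le_of_eq ?_)
    rw [hEdef, hLamdef, hΓdef]
    dsimp only
    rw [hℓDdef, hJdef, hCKdef, hN'def, hlogR]
    ring
  -- Step 3: sums over the exceptional primes and the squares
  have hexc : ∑ p ∈ excRange χ R₀ x, aCorr ψ R Dr P h₁ h₂ x p ≤
      x * Lam * (1944 * Γ 1) * (K' * Real.exp (-(ℓ ^ 10) / 2)) + 3 * Real.sqrt x * E := by
    have hmem : ∀ p ∈ excRange χ R₀ x, p.Prime := fun p hp => by
      unfold excRange at hp; exact (Finset.mem_filter.mp hp).2.1
    have h1 : ∑ p ∈ excRange χ R₀ x, aCorr ψ R Dr P h₁ h₂ x p ≤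
        ∑ p ∈ excRange χ R₀ x, (x * Lam * (1944 * Γ 1) * ((1 : ℝ) / p) + E) := by
      refine Finset.sum_le_sum fun p hp => ?_
      have := hper (hmem p hp) 1
      rw [pow_one] at this
      refine this.trans (le_of_eq ?_)
      rw [pow_one]; ring
    have hSig : ∑ p ∈ excRange χ R₀ x, (1 : ℝ) / p ≤ K' * Real.exp (-(ℓ ^ 10) / 2) := by
      have h2 := h36 q χ hS.1 hS.2.1 η hη₀ hS.2.2.2 (x : ℝ)
        (by rw [show ((1 : ℝ) + 1) / 2 = 1 by norm_num, Real.rpow_one]; exact hqx) hxhi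
      have h3 := sum_inv_excRange_le χ hx2 R₀
      have hR₀eq : (x : ℝ) ^ (1 / Real.sqrt (Real.log η)) = R₀ := by rw [hR₀def]; rfl
      rw [hR₀eq] at h2
      calc ∑ p ∈ excRange χ R₀ x, (1 : ℝ) / p ≤ _ := h3
        _ ≤ K₃₆ * Real.exp (-Real.sqrt (Real.log η) / 2) := h2
        _ ≤ K' * Real.exp (-(ℓ ^ 10) / 2) := by
            rw [← hℓ10]
            exact mul_le_mul_of_nonneg_right (le_max_left _ _) (Real.exp_pos _).le
    have hcard : ((excRange χ R₀ x).card : ℝ) ≤ 3 * Real.sqrt x :=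
      card_sqRange_le (by omega) _ (excRange_subset χ R₀ x)
    calc ∑ p ∈ excRange χ R₀ x, aCorr ψ R Dr P h₁ h₂ x p
        ≤ ∑ p ∈ excRange χ R₀ x, (x * Lam * (1944 * Γ 1) * ((1 : ℝ) / p) + E) := h1
      _ = x * Lam * (1944 * Γ 1) * ∑ p ∈ excRange χ R₀ x, (1 : ℝ) / p + (excRange χ R₀ x).card * E := by
          rw [Finset.sum_add_distrib, Finset.mul_sum, Finset.sum_const, nsmul_eq_mul]
      _ ≤ x * Lam * (1944 * Γ 1) * (K' * Real.exp (-(ℓ ^ 10) / 2)) + 3 * Real.sqrt x * E := by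
          have := hΓ0 1
          exact add_le_add (mul_le_mul_of_nonneg_left hSig (by positivity))
            (mul_le_mul_of_nonneg_right hcard hE0)
  have hsq : ∑ p ∈ sqRange R₀ x, aCorr ψ R Dr P h₁ h₂ x (p ^ 2) ≤
      x * Lam * (1944 * Γ 2) * (2 * Real.exp (-(ℓ ^ 10 / cS))) + 3 * Real.sqrt x * E := by
    have hmem : ∀ p ∈ sqRange R₀ x, p.Prime := fun p hp => by
      unfold sqRange at hp; exact (Finset.mem_filter.mp hp).2.1
    have h1 : ∑ p ∈ sqRange R₀ x, aCorr ψ R Dr P h₁ h₂ x (p ^ 2) ≤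
        ∑ p ∈ sqRange R₀ x, (x * Lam * (1944 * Γ 2) * ((1 : ℝ) / (p : ℝ) ^ 2) + E) := by
      refine Finset.sum_le_sum fun p hp => ?_
      refine (hper (hmem p hp) 2).trans (le_of_eq ?_)
      ring
    have hSig : ∑ p ∈ sqRange R₀ x, (1 : ℝ) / (p : ℝ) ^ 2 ≤ 2 * Real.exp (-(ℓ ^ 10 / cS)) := by
      refine (sum_inv_sq_sqRange_le hR₀pos x).trans ?_
      rw [hR₀exp, div_eq_mul_inv, ← Real.exp_neg]
      refine mul_le_mul_of_nonneg_left (Real.exp_le_exp.mpr ?_) (by norm_num)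
      linarith [huℓcS]
    have hcard : ((sqRange R₀ x).card : ℝ) ≤ 3 * Real.sqrt x :=
      card_sqRange_le (by omega) _ (sqRange_subset R₀ x)
    calc ∑ p ∈ sqRange R₀ x, aCorr ψ R Dr P h₁ h₂ x (p ^ 2)
        ≤ ∑ p ∈ sqRange R₀ x, (x * Lam * (1944 * Γ 2) * ((1 : ℝ) / (p : ℝ) ^ 2) + E) := h1
      _ = x * Lam * (1944 * Γ 2) * ∑ p ∈ sqRange R₀ x, (1 : ℝ) / (p : ℝ) ^ 2 + (sqRange R₀ x).card * E := by
          rw [Finset.sum_add_distrib, Finset.mul_sum, Finset.sum_const, nsmul_eq_mul]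
      _ ≤ x * Lam * (1944 * Γ 2) * (2 * Real.exp (-(ℓ ^ 10 / cS))) + 3 * Real.sqrt x * E := by
          have := hΓ0 2
          exact add_le_add (mul_le_mul_of_nonneg_left hSig (by positivity))
            (mul_le_mul_of_nonneg_right hcard hE0)
  -- Step 4: the main terms
  have hdecay : ∀ {c : ℝ}, 0 < c → ℓ ^ (14 + 2 * N') * Real.exp (-(ℓ ^ 10 / c)) ≤ c ^ (N' + 2) * Fac / ℓ := by
    intro c hc
    have h1 := pow_mul_exp_neg_le ℓ hc (N' + 2)
    rw [← hFacdef] at h1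
    rw [le_div_iff₀ hℓ0]
    have hpow : ℓ ^ (14 + 2 * N') * ℓ ≤ ℓ ^ (10 * (N' + 2)) := by
      rw [← pow_succ]
      exact pow_le_pow_right₀ hℓ1 (by omega)
    calc ℓ ^ (14 + 2 * N') * Real.exp (-(ℓ ^ 10 / c)) * ℓ = (ℓ ^ (14 + 2 * N') * ℓ) * Real.exp (-(ℓ ^ 10 / c)) := by
          ring
      _ ≤ ℓ ^ (10 * (N' + 2)) * Real.exp (-(ℓ ^ 10 / c)) :=
          mul_le_mul_of_nonneg_right hpow (Real.exp_pos _).le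
      _ ≤ c ^ (N' + 2) * Fac := h1
  have hu2t2 : u ^ 2 / t ^ 2 = ℓ ^ 4 := by
    rw [hut]; field_simp
  have hmain : Cred * u ^ 2 * ℓ ^ 10 * (x * Lam * (1944 * Γ 1) * (K' * Real.exp (-(ℓ ^ 10) / 2)) +
      x * Lam * (1944 * Γ 2) * (2 * Real.exp (-(ℓ ^ 10 / cS)))) ≤ Cmain * x / ℓ := by
    have hΓ1 := hΓle 1 (by norm_num)
    have hΓ2 := hΓle 2 le_rfl
    -- rewrite `u² Lam = 16 CK J⁴ ℓ⁴`
    have hLamu : u ^ 2 * Lam = 16 * CK * J ^ 4 * ℓ ^ 4 := by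
      rw [hLamdef, show u ^ 2 * (16 * CK * J ^ 4 / t ^ 2) = 16 * CK * J ^ 4 * (u ^ 2 / t ^ 2) by ring, hu2t2]
    have hd1 : ℓ ^ (14 + 2 * N') * Real.exp (-(ℓ ^ 10) / 2) ≤ 2 ^ (N' + 2) * Fac / ℓ := by
      have := hdecay two_pos
      rwa [show -(ℓ ^ 10 / 2) = -(ℓ ^ 10) / 2 by ring] at this
    have hd2 : ℓ ^ (14 + 2 * N') * Real.exp (-(ℓ ^ 10 / cS)) ≤ cS ^ (N' + 2) * Fac / ℓ := hdecay hcS0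
    have hℓ14 : ℓ ^ 10 * ℓ ^ 4 * ℓ ^ (2 * N') = ℓ ^ (14 + 2 * N') := by
      rw [← pow_add, ← pow_add]
    -- both summands
    have hA : Cred * u ^ 2 * ℓ ^ 10 * (x * Lam * (1944 * Γ 1) * (K' * Real.exp (-(ℓ ^ 10) / 2))) ≤
        Cred * (16 * CK * J ^ 4) * 1944 * Γ₀ * (K' * (2 ^ (N' + 2) * Fac)) * x / ℓ := by
      calc Cred * u ^ 2 * ℓ ^ 10 * (x * Lam * (1944 * Γ 1) * (K' * Real.exp (-(ℓ ^ 10) / 2)))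
          = Cred * (u ^ 2 * Lam) * 1944 * K' * x * (ℓ ^ 10 * Γ 1 * Real.exp (-(ℓ ^ 10) / 2)) := by ring
        _ ≤ Cred * (u ^ 2 * Lam) * 1944 * K' * x * (ℓ ^ 10 * (Γ₀ * ℓ ^ (2 * N')) * Real.exp (-(ℓ ^ 10) / 2)) := by
            have h0 : 0 ≤ Cred * (u ^ 2 * Lam) * 1944 * K' * x := by positivity
            refine mul_le_mul_of_nonneg_left ?_ h0
            exact mul_le_mul_of_nonneg_right (mul_le_mul_of_nonneg_left hΓ1 (by positivity)) (Real.exp_pos _).le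
        _ = Cred * (16 * CK * J ^ 4) * 1944 * Γ₀ * K' * x * (ℓ ^ (14 + 2 * N') * Real.exp (-(ℓ ^ 10) / 2)) := by
            rw [hLamu, ← hℓ14]; ring
        _ ≤ Cred * (16 * CK * J ^ 4) * 1944 * Γ₀ * K' * x * (2 ^ (N' + 2) * Fac / ℓ) :=
            mul_le_mul_of_nonneg_left hd1 (by positivity)
        _ = _ := by ring
    have hB' : Cred * u ^ 2 * ℓ ^ 10 * (x * Lam * (1944 * Γ 2) * (2 * Real.exp (-(ℓ ^ 10 / cS)))) ≤
        Cred * (16 * CK * J ^ 4) * 1944 * Γ₀ * (2 * (cS ^ (N' + 2) * Fac)) * x / ℓ := by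
      calc Cred * u ^ 2 * ℓ ^ 10 * (x * Lam * (1944 * Γ 2) * (2 * Real.exp (-(ℓ ^ 10 / cS))))
          = Cred * (u ^ 2 * Lam) * 1944 * 2 * x * (ℓ ^ 10 * Γ 2 * Real.exp (-(ℓ ^ 10 / cS))) := by ring
        _ ≤ Cred * (u ^ 2 * Lam) * 1944 * 2 * x * (ℓ ^ 10 * (Γ₀ * ℓ ^ (2 * N')) * Real.exp (-(ℓ ^ 10 / cS))) := by
            have h0 : 0 ≤ Cred * (u ^ 2 * Lam) * 1944 * 2 * x := by positivity
            refine mul_le_mul_of_nonneg_left ?_ h0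
            exact mul_le_mul_of_nonneg_right (mul_le_mul_of_nonneg_left hΓ2 (by positivity)) (Real.exp_pos _).le
        _ = Cred * (16 * CK * J ^ 4) * 1944 * Γ₀ * 2 * x * (ℓ ^ (14 + 2 * N') * Real.exp (-(ℓ ^ 10 / cS))) := by
            rw [hLamu, ← hℓ14]; ring
        _ ≤ Cred * (16 * CK * J ^ 4) * 1944 * Γ₀ * 2 * x * (cS ^ (N' + 2) * Fac / ℓ) :=
            mul_le_mul_of_nonneg_left hd2 (by positivity)
        _ = _ := by ring
    rw [mul_add]
    refine (add_le_add hA hB').trans (le_of_eq ?_)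
    rw [hCmaindef]; ring
  -- Step 5: the error terms
  have herr : Cred * u ^ 2 * ℓ ^ 10 * (3 * Real.sqrt x * E + 3 * Real.sqrt x * E) ≤ Cerr * x / ℓ := by
    have hceil : (B * ⌈R⌉₊) ^ 4 ≤ 16 * B ^ 4 * Real.exp (u / 8) := by
      have h1 : ((⌈R⌉₊ : ℕ) : ℝ) ≤ 2 * R := by
        have := Nat.ceil_lt_add_one hR0.le; linarith
      have h2 : R ^ 4 ≤ Real.exp (u / 8) := by
        rw [hRexp, ← Real.exp_nat_mul, Real.exp_le_exp]
        push_cast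
        rw [hut]
        have h36' : 36 ≤ ℓ ^ 2 := by
          rw [pow_two]; exact le_trans (by norm_num) (mul_le_mul hℓ6 hℓ6 (by norm_num) (by linarith))
        have := mul_le_mul_of_nonneg_left h36' ht0.le
        linarith
      calc (B * ⌈R⌉₊) ^ 4 ≤ (B * (2 * R)) ^ 4 :=
            pow_le_pow_left₀ (by positivity) (mul_le_mul_of_nonneg_left h1 hB0) 4
        _ = 16 * B ^ 4 * R ^ 4 := by ring
        _ ≤ 16 * B ^ 4 * Real.exp (u / 8) := mul_le_mul_of_nonneg_left h2 (by positivity)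
    have hSa := tau_sum_sq_le hCτ1 hτ hDr1 (Dr := Dr)
    have hEle : E ≤ 16 * B ^ 4 * Real.exp (u / 8) * (Cτ ^ (2 * P) * Real.exp (u / 8)) := by
      rw [hEdef]
      exact mul_le_mul hceil (hSa.trans (mul_le_mul_of_nonneg_left hDr52 (by positivity)))
        hτsum0 (by positivity)
    have hsqrtx : Real.sqrt x = Real.exp (u / 2) := by
      rw [← hxu, show Real.exp u = Real.exp (u / 2) ^ 2 by rw [← Real.exp_nat_mul]; congr 1; push_cast; ring]
      exact Real.sqrt_sq (Real.exp_pos _).le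
    have hu2 := sq_le_exp_sixteenth hu0.le
    have hℓ11 := pow_eleven_le_exp hℓ2' huℓ
    -- assemble: `u² ℓ^{10} √x E ≤ 512·16B⁴Cτ^{2P} · ℓ^{10} e^{13u/16} ≤ … x/ℓ`
    have hexp : Real.exp (u / 16) * Real.exp (u / 2) * (Real.exp (u / 8) * Real.exp (u / 8)) =
        Real.exp u * Real.exp (-(3 * u / 16)) := by
      rw [← Real.exp_add, ← Real.exp_add, ← Real.exp_add, ← Real.exp_add]; congr 1; ring
    have hℓinv : ℓ ^ 10 * Real.exp (-(3 * u / 16)) ≤ 1 / ℓ := by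
      rw [Real.exp_neg, le_div_iff₀ hℓ0]
      have he : 0 < Real.exp (3 * u / 16) := Real.exp_pos _
      calc ℓ ^ 10 * (Real.exp (3 * u / 16))⁻¹ * ℓ = ℓ ^ 11 * (Real.exp (3 * u / 16))⁻¹ := by ring
        _ ≤ Real.exp (3 * u / 16) * (Real.exp (3 * u / 16))⁻¹ :=
            mul_le_mul_of_nonneg_right hℓ11 (by positivity)
        _ = 1 := mul_inv_cancel₀ he.ne'
    calc Cred * u ^ 2 * ℓ ^ 10 * (3 * Real.sqrt x * E + 3 * Real.sqrt x * E)
        = Cred * 6 * (u ^ 2 * (ℓ ^ 10 * (Real.sqrt x * E))) := by ring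
      _ ≤ Cred * 6 * ((512 * Real.exp (u / 16)) * (ℓ ^ 10 * (Real.exp (u / 2) *
          (16 * B ^ 4 * Real.exp (u / 8) * (Cτ ^ (2 * P) * Real.exp (u / 8)))))) := by
          refine mul_le_mul_of_nonneg_left ?_ (by positivity)
          refine mul_le_mul hu2 (mul_le_mul_of_nonneg_left ?_ hℓ10pos.le)
            (mul_nonneg hℓ10pos.le (mul_nonneg (Real.sqrt_nonneg _) hE0)) (by positivity)
          rw [hsqrtx]
          exact mul_le_mul_of_nonneg_left hEle (Real.exp_pos _).le
      _ = Cred * 6 * (16 * B ^ 4) * Cτ ^ (2 * P) * 512 *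
          ((Real.exp (u / 16) * Real.exp (u / 2) * (Real.exp (u / 8) * Real.exp (u / 8))) * ℓ ^ 10) := by
          ring
      _ = Cred * 6 * (16 * B ^ 4) * Cτ ^ (2 * P) * 512 *
          (Real.exp u * (ℓ ^ 10 * Real.exp (-(3 * u / 16)))) := by
          rw [hexp]; ring
      _ ≤ Cred * 6 * (16 * B ^ 4) * Cτ ^ (2 * P) * 512 * (Real.exp u * (1 / ℓ)) := by
          refine mul_le_mul_of_nonneg_left (mul_le_mul_of_nonneg_left hℓinv (Real.exp_pos _).le) (by positivity)
      _ = Cerr * x / ℓ := by rw [hCerrdef, hxu]; ring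
  -- the goal
  rw [div_le_iff₀ hx0]
  have hgoalℓ : (Cmain + Cerr) / Real.log η ^ ((1 : ℝ) / 20) * x = (Cmain + Cerr) * x / ℓ := by
    rw [hℓdef]; ring
  rw [hgoalℓ]
  have hsum0 : 0 ≤ ∑ p ∈ excRange χ R₀ x, aCorr ψ R Dr P h₁ h₂ x p + ∑ p ∈ sqRange R₀ x, aCorr ψ R Dr P h₁ h₂ x (p ^ 2) :=
    add_nonneg (Finset.sum_nonneg fun p _ => aCorr_nonneg _ _ _ _ _ _ _ _)
      (Finset.sum_nonneg fun p _ => aCorr_nonneg _ _ _ _ _ _ _ _)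
  calc ∑ n ∈ Icc 1 x, pairErrE χ ψ η x (n + h₁) *
        (sievedVonMangoldt ψ (pairScaleR η x) (n + h₂) + pairErrE χ ψ η x (n + h₂) +
          pairErrF ψ η ε₀ A x (n + h₂) + pairErrG χ ψ η x (n + h₂))
      ≤ CL * Real.log x * (2 * Real.log (2 * x) + 2 * Real.log (2 * x) * CL * Real.log x / Real.log R₀ +
          Real.log x) *
          (∑ p ∈ excRange χ R₀ x, aCorr ψ R Dr P h₁ h₂ x p + ∑ p ∈ sqRange R₀ x, aCorr ψ R Dr P h₁ h₂ x (p ^ 2)) :=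
        hred
    _ ≤ Cred * u ^ 2 * ℓ ^ 10 *
          (∑ p ∈ excRange χ R₀ x, aCorr ψ R Dr P h₁ h₂ x p + ∑ p ∈ sqRange R₀ x, aCorr ψ R Dr P h₁ h₂ x (p ^ 2)) :=
        mul_le_mul_of_nonneg_right hΞ hsum0
    _ ≤ Cred * u ^ 2 * ℓ ^ 10 *
          ((x * Lam * (1944 * Γ 1) * (K' * Real.exp (-(ℓ ^ 10) / 2)) + 3 * Real.sqrt x * E) +
            (x * Lam * (1944 * Γ 2) * (2 * Real.exp (-(ℓ ^ 10 / cS))) + 3 * Real.sqrt x * E)) :=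
        mul_le_mul_of_nonneg_left (add_le_add hexc hsq) (by positivity)
    _ = Cred * u ^ 2 * ℓ ^ 10 * (x * Lam * (1944 * Γ 1) * (K' * Real.exp (-(ℓ ^ 10) / 2)) +
          x * Lam * (1944 * Γ 2) * (2 * Real.exp (-(ℓ ^ 10 / cS)))) +
          Cred * u ^ 2 * ℓ ^ 10 * (3 * Real.sqrt x * E + 3 * Real.sqrt x * E) := by ring
    _ ≤ Cmain * x / ℓ + Cerr * x / ℓ := add_le_add hmain herr
    _ = (Cmain + Cerr) * x / ℓ := by ring

end Literature.Barriers.Parity
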